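import Literature.MathematicalPhysics.QuantumFieldTheory.Dimock2011to13.QED3CommutatorBoundsTorus
import HarnessLib

/-!
# Dimock, *QED on the 3-torus. II*, §3.3 THEOREM 2 proof (199)–(201) ON THE DISCRETE TORUS for `h_□ :=` the periodized
# (124): the boson later-link bound «`|(R_□G*_□)(x,y)| ≤ O(1)M₀^{−1}(L^{2(k−i)}d′(x,y)^{−1} + L^{k−i}d′(x,y)^{−2})exp(−O(1)d_Λ(x,y))`»
# DERIVED from LEMMA 3 (198) (value AND gradient bounds of `G*_□`) and the kernel shapes of `−Δ + μ_k² + QᵀaQ` ((197), (200)):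
# the Laplacian part by the printed second-order split «`(−Δh_□)G* + (∂h_□)∂G* + (∂ᵀh_□)∂ᵀG*`», the averaging part «the same
# bound holds easily»; then THEOREM 2 (195), single scale on the 3-torus, FROM LEMMA 3 ALONE (`dimock_thm2_torus_lemma3`)

statement-level skeleton of published theorems with citation tags; proofs where landed; nothing here is a claim about the Yang–Mills mass gap

**Citation header (reproduction of PUBLISHED work).** J. Dimock, *Quantum electrodynamics on the 3-torus. II. The
renormalization group flow*, arXiv:math-ph/0407063 (2004) [Dimock2004QED3TorusII], §3.3 «bosons», THEOREM 2 (194)–(196)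
p.30 L1–13, LEMMA 3 (197)–(198) p.30 L14–22, proof (199)–(203) p.30 L24 – p.31 L6; §3.2 THEOREM 1 proof Part II (145),
(150) p.23 L66 – p.24 L42 and §3.1 (124)–(126), LEMMA 1 (129); of the held arXiv text layer `paper:arxiv-math-ph_0407063`
(`p.NN Lnn` = PDF page ∕ text-layer line).  Writer seat p11 (literature-prover-lit-balaban-p11-g24-0), YM LIT SWEEP item
(c) D13 (row C13 «WHERE»; zero weight for the YM-INPRINT tokens).  Imports the tree's `QED3CommutatorBoundsTorus` (the
fermion Part II on the torus: `torusDist_le_of_mem_tball`, `supN∕dOne_vmaVec_sub_le_of_mem_tball`, `norm_link0_le`; through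
it `QED3SingleScaleTheorem1Torus.dimock_thm2_torus_dprime` = THEOREM 2 single scale on the torus with (201) as hypothesis,
`h125_torus`, `czmap_centre_site`; `QED3TorusPartitionOfUnity.abs_sub_g_torus_le`, `mem_tball_of_g_torus_ne_zero`;
`QED3BlockPotentialSumsTorus.eq129_torus`; `QED3CommutatorBounds.profile_hop_le`; `QED3SquarePartitionOfUnity`'s bump `g`).

**The printed text** (p.30 L14–45).  *"Lemma 3 Under the same hypotheses for each `D_i` block `□` there is an operator
`G*_□` such that for `x ∈ □̃`: `((−Δ + μ_k² + Qᵀ_{k,Λ}aQ_{k,Λ})G*_□f)(x) = f(x)` (197) and for `x, y ∈ □̃`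
`|G*_□(x,y)| ≤ O(1)d′(x,y)^{−1}exp(−O(1)d_Λ(x,y))`, `|∂G*_□(x,y)| ≤ O(1)(L^{k−i}d′(x,y)^{−1} + d′(x,y)^{−2})exp(−O(1)d_Λ(x,y))`
(198) … The random walk expansion has the form `G_{k,Λ} = Σ_{n=0}^∞Σ_{□_0,□_1,…,□_n}(h_{□_0}G*_{□_0}h_{□_0})(R_{□_1}G*_{□_1}
h_{□_1})⋯(R_{□_n}G*_{□_n}h_{□_n}) ≡ Σ_ω G_{k,Λ,ω}` (199) where now `R_□ = −[(−Δ + μ_k² + Qᵀ_{k,Λ}aQ_{k,Λ}), h_□]` (200) We write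
`R_□ = R^Δ_□ + R^Q_□` and estimate for `□ ∈ D_i` `|(R^Δ_□G*_□)(x,y)| = |(−Δh_□)(x)G*_□(x,y) + (∂h_□)(x)∂G*_□(x,y) +
(∂ᵀh_□)(x)∂ᵀG*_□(x,y)| ≤ O(1)M₀^{−1}(L^{2(k−i)}d′(x,y)^{−1} + L^{k−i}d′(x,y)^{−2})exp(−O(1)d_Λ(x,y))` (201) The same bound
holds easily for `|(R^Q_□G*_□)(x,y)|` and hence it holds also for `|(R_□G*_□)(x,y)|`. Now we follow the proof of theorem 1."*

**What is formalized (kernel-checked, zero `sorry`, no named facts).**  The setting of `QED3CommutatorBoundsTorus`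
(sites `X` embedded injectively by `e` in the site torus `(ℤ∕N_s)³` at spacing `η`, unit blocks `Δ_x = czmap ℓ_b N_b (e x)`
of `ℓ_b` sites, cubes of `M₀` blocks, `ℓ = ℓ_bM₀`, the periodized bump `h_w(x) = g(ℓ^{−1}·valMinAbs(e x − cz w) − t)`), now
with the LATTICE STRUCTURE of `X` given by neighbour maps `x ↦ x ± e_μ` (`e(x + e_μ) = e x + e_μ` on the torus), the
operator `A` with off-diagonal entries `A_Δ + A_Q` where `A_Δ` ACTS AS `−Δ = −η^{−2}Σ_μ(f(x + e_μ) + f(x − e_μ) − 2f(x))`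
((197); its diagonal and the mass `μ_k²` commute with `h_□`) and `A_Q(x,u) ≠ 0 ⟹ Δ_u = Δ_x`, `‖A_Q‖ ≤ a_Q` (the block
average `QᵀaQ`, (147) at `L^{2(k−i)} = 1` against `Ση³`: `a_Q = aη³`), and local inverses `G*_□ = G_w` obeying LEMMA 3 (198)
in the printed currency: `‖G_w(u,v)‖ ≤ C₀η³d′_T(e u,e v)^{−1}e^{−c·d(Δ_u,Δ_v)}` and the FORWARD LATTICE DERIVATIVE
`‖G_w(x + e_μ,v) − G_w(x,v)‖ ≤ C₀′·η·η³(d′_T^{−1} + d′_T^{−2})(e x,e v)e^{−c·d(Δ_x,Δ_v)}`.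
* §1 **the bump has Lipschitz derivative** — `exists_lipschitzWith_fderiv_g` (compact support, `C^∞`: Mathlib's
  `ContDiff.lipschitzWith_of_hasCompactSupport` applied to `g′`) and the SECOND DIFFERENCE bound `abs_g_second_diff_le`:
  `|g(p + v) + g(p − v) − 2g(p)| ≤ G₂‖v‖²` for `g′` `G₂`-Lipschitz (mean value inequality for `q ↦ g(q + v) − g(q)`).
* §2 **«`(−Δh_□)(x)`» on the torus** — `abs_second_diff_g_torus_le`: for the periodized bump and a lattice step `δ`
  (`|δ|_∞ ≤ 1`), `|h_w(x + δ) + h_w(x − δ) − 2h_w(x)| ≤ G₂ℓ^{−2}` — provided the support window stays two sites clear of the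
  antipode (`ℓ(|t| + 3∕5) + 2 < N_s∕2`; at a wrap of the minimal lift all three values vanish).
* §3 **«we use (129)» at `α = 1`** — `sum_block_dprimeT_one_le`: `Σ_{u : Δ_u = Δ_x}η³d′_T(e u,e v)^{−1} ≤ κ₁d′_T(e x,e v)^{−1}`,
  `κ₁ = 2(ηR)³ + 2C(1)(ηR)²(ηℓ_b)` (two cases, as in the fermion file; no loss of decay).
* §4 **(200)–(201) ⟹ the later-link bound, on the torus** — `norm_linkR_le_split` (the later link split into the
  Laplacian sum and the averaging sum), `laplacian_comm_sum_eq` (the Laplacian commutator sum REARRANGED EXACTLY: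
  `Σ_u(h(x) − h(u))A_Δ(x,u)S(u) = −η^{−2}Σ_μ[(h(x) − h(x+e_μ))S(x+e_μ) + (h(x) − h(x−e_μ))S(x−e_μ)]`, the diagonal cancels),
  **`sum_laplacian_part_le`** = (201): symmetric ∕ antisymmetric split `aS₊ + bS₋ = ½(a+b)(S₊+S₋) + ½(a−b)(S₊−S₋)` with
  `|a + b| = |(Δ_μh)(x)| ≤ G₂ℓ^{−2}` (§2), `|a − b| = |h(x−e_μ) − h(x+e_μ)| ≤ 2Gℓ^{−1}` ((145) on the torus), `‖S_±‖` by (198)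
  with hop comparability, `‖S₊ − S₋‖` by the GRADIENT bound (198) at `x` and at `x − e_μ` (comparability): `≤ C_Δ∕M₀ ·
  η³(d′_T^{−1} + d′_T^{−2})e^{−cd}`, `C_Δ = 3e^{6c}(4G₂C₀(ηℓ_b)^{−2} + 5GC₀′(ηℓ_b)^{−1})` (`M₀ ≥ 1`); `sum_avg_part_one_le`
  («the same bound holds easily for `R^Q_□`»: (150) + §3); **`eq201_torus`**: `‖(R_□G*_□h_□)(x,v)‖ ≤ C₁∕M₀ ·
  η³(d′_T^{−1} + d′_T^{−2})(e x,e v)e^{−c·d(Δ_x,Δ_v)}`, `C₁ = C_Δ + Ga_QC₀κ₁∕η³` — the hypothesis `hR'` of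
  `dimock_thm2_torus_dprime`, same decay rate as (198).
* §5 **`dimock_thm2_torus_printed`** ((125) and the supports derived for the periodized (124), as in the fermion file) and
  **`dimock_thm2_torus_lemma3`** — THEOREM 2 (195), single scale on the 3-torus, FROM LEMMA 3 ALONE: hypotheses (197) in
  the form `h_□AG*_□ = h_□`, (198) value + gradient, the kernel shapes, the window ∕ size conditions and *"Let `M_0` be
  sufficiently large"* with the explicit constant; conclusion: the walk expansion (199) converges entrywise,
  `A·G_k = 1`, and (195) `‖G_k(x,y)‖ ≤ 2·3³·C₀·η³d′_T(e x,e y)^{−1}e^{−(c∕2)d(Δ_x,Δ_y)}`;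
  **`dimock_thm2_torus_uniform`** (unit blocks `ηℓ_b = 1`, `R = ℓ_b`, `a_Q = aη³`: `C₁ = 3e^{6c}(4G₂C₀ + 5GC₀′) +
  GaC₀(2 + 2C(1))`, `θ′ = 4C(1) + 2√8C(2) + 8C(2)`, independent of `k` and of the volume — ONE explicit `M₀`) and
  **`dimock_thm2_torus_uniform'`** (the bookkeeping discharged: `t = τ = 0`, `r = ℓ_b(M₀ − 4)`, `N_c ≥ 2`, `M₀ ≥ 12`).

**Readings (declared).**  (i) The KERNEL SHAPE of `−Δ + μ_k² + QᵀaQ` is the hypothesis (the unit-lattice Laplacian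
at spacing `η`, a block-average part, a free diagonal); gauge fields do not enter the boson operator (197).  (ii) The
printed split (201) `(−Δh)G* + (∂h)∂G* + (∂ᵀh)∂ᵀG*` is realised as the symmetric ∕ antisymmetric rearrangement of the
lattice commutator (exact on the lattice; `∂`, `∂ᵀ` = forward ∕ backward differences); `(Δh_□) = O(ℓ^{−2})` needs
`g′` Lipschitz (§1), `∂h_□ = O(ℓ^{−1})` is (145).  (iii) Decay currency, block-level comparability (`e^{6c}`) and the
two-case form of «we use (129)» as in `QED3CommutatorBoundsTorus` (readings (ii)–(iii) there).  (iv) With the printed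
sizes (`ηℓ_b = 1`, `a_Q = aη³`, `R = ℓ_b`) `C₁` does not depend on `k` or the volume (`O(1)M₀^{−1}` as printed).  (v) The
nearest-neighbour support of `A_Δ` (`hADr`, used only for the range of `A`) is implied by its kernel; it is taken as a
separate hypothesis.  (vi) The window `ℓ(|t| + 3∕5) + ℓ_b + 2 < N_s∕2` (support of `h_□` plus one block plus two sites clear
of the antipode) is automatic for the paper's tori (`N_c ≥ 3`).

**Honest scope.**  HYPOTHESES, in printed shape: LEMMA 3 ((197) as `h_□AG*_□ = h_□`, (198) value and forward-gradient
bounds on all entries — the local inverses are not constructed here), the kernel shapes of `A`, `E` a complete normed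
`ℝ`-algebra with `‖1‖ = 1`, the window ∕ size conditions.  Single scale only (full torus, Remark 3); the derivative
bounds (196) of THEOREM 2 and the multiscale statement are NOT touched.  No `d = 4` statement; nothing about Bałaban's
papers beyond the reuse of the cell's torus carrier as geometry.

**Version.**  v1.1 — ADDITIVE to v1 (p359112, commit b629576cfa6b): + `dimock_thm2_torus_uniform`, `dimock_thm2_torus_uniform'`
(§5); every v1 declaration byte-identical.
-/

noncomputable section

namespace Literature.MathematicalPhysics.QuantumFieldTheory.Dimock2011to13

namespace QED3TorusII

open Finset Real
open scoped NNReal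
open RandomWalkExpansion (Kz Gstar Kop)
open Balaban1983to89.B13ScaleTransfer (Pt)
open Balaban1983to89.TreeLengthTorus (TPt proj natLift proj_natLift)
open Balaban1983to89.B12Decay510Window (K₁)
open Balaban1983to89.B12Decay510Torus (vmaVec)
open RandomWalkTorusDecay (torusDist torusDist_nonneg torusDist_triangle)
open RegionVolume (box mem_box tball mem_tball tball_mono self_mem_tball czmap czmap_mem_tball mem_tball_of_czmap_eq
  proj_add)
open QED3SquarePartition (g g_nonneg g_le_one g_eq_zero_of_coord contDiff_g hasCompactSupport_g)

/-! ## §1 The bump has Lipschitz derivative; the second difference -/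

section Analysis

variable {ι : Type*} [Fintype ι]

/-- the derivative of the tree's bump `g` ((124)) is LIPSCHITZ (it is `C^∞` with compact support) — the input
«`(−Δh_□)(x) = O(ℓ^{−2})`» of (201); the constant is not computed. [cite: Dimock2004QED3TorusII, §3.1 (124) p.20 L82–84 and §3.3 (201) p.30 L40–44] -/
theorem exists_lipschitzWith_fderiv_g : ∃ G₂ : ℝ≥0, LipschitzWith G₂ (fderiv ℝ (g : (ι → ℝ) → ℝ)) := by
  have hinf : ContDiff ℝ ((⊤ : ℕ∞) : WithTop ℕ∞) (g : (ι → ℝ) → ℝ) := contDiff_g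
  have h1 : ContDiff ℝ ((⊤ : ℕ∞) : WithTop ℕ∞) (fderiv ℝ (g : (ι → ℝ) → ℝ)) :=
    (contDiff_infty_iff_fderiv.1 hinf).2
  exact ContDiff.lipschitzWith_of_hasCompactSupport (HasCompactSupport.fderiv (𝕜 := ℝ) hasCompactSupport_g) h1
    (by simp)

/-- **the second difference of the bump**: `|g(p + v) + g(p − v) − 2g(p)| ≤ G₂‖v‖²` when `g′` is `G₂`-Lipschitz — the
mean value inequality for `q ↦ g(q + v) − g(q)`, whose derivative `g′(q + v) − g′(q)` has norm `≤ G₂‖v‖`.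
[cite: Dimock2004QED3TorusII, §3.3 (201) p.30 L40–44 («(−Δh_□)(x)»)] -/
theorem abs_g_second_diff_le {G₂ : ℝ≥0} (hG₂ : LipschitzWith G₂ (fderiv ℝ (g : (ι → ℝ) → ℝ)))
    (p v : ι → ℝ) : |g (p + v) + g (p - v) - 2 * g p| ≤ (G₂ : ℝ) * ‖v‖ ^ 2 := by
  have hinf : ContDiff ℝ ((⊤ : ℕ∞) : WithTop ℕ∞) (g : (ι → ℝ) → ℝ) := contDiff_g
  have hd : Differentiable ℝ (g : (ι → ℝ) → ℝ) := hinf.differentiable (by simp)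
  -- the derivative moves by at most `G₂‖v‖`
  have hlip : ∀ q : ι → ℝ, ‖fderiv ℝ (g : (ι → ℝ) → ℝ) (q + v) - fderiv ℝ (g : (ι → ℝ) → ℝ) q‖ ≤ G₂ * ‖v‖ := by
    intro q
    have h := hG₂.norm_sub_le (q + v) q
    rwa [add_sub_cancel_left] at h
  -- `F q = g(q + v) − g(q)`
  have hshift : ∀ q : ι → ℝ, DifferentiableAt ℝ (fun q : ι → ℝ => g (q + v)) q := fun q =>
    DifferentiableAt.comp (g := (g : (ι → ℝ) → ℝ)) (f := fun y : ι → ℝ => y + v) q (hd (q + v))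
      (differentiableAt_id.add_const v)
  have hFdiff : ∀ q : ι → ℝ, DifferentiableAt ℝ (fun q : ι → ℝ => g (q + v) - g q) q := fun q =>
    (hshift q).fun_sub (hd q)
  have hFderiv : ∀ q : ι → ℝ, fderiv ℝ (fun q : ι → ℝ => g (q + v) - g q) q
      = fderiv ℝ (g : (ι → ℝ) → ℝ) (q + v) - fderiv ℝ (g : (ι → ℝ) → ℝ) q := by
    intro q
    rw [fderiv_fun_sub (hshift q) (hd q), fderiv_comp_add_right]
  have hFb : ∀ q : ι → ℝ, ‖fderiv ℝ (fun q : ι → ℝ => g (q + v) - g q) q‖ ≤ G₂ * ‖v‖ := fun q => by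
    rw [hFderiv]
    exact hlip q
  have h := Convex.norm_image_sub_le_of_norm_fderiv_le (f := fun q : ι → ℝ => g (q + v) - g q) (s := Set.univ)
    (fun z _ => hFdiff z) (fun z _ => hFb z) convex_univ (Set.mem_univ (p - v)) (Set.mem_univ p)
  rw [sub_sub_cancel, Real.norm_eq_abs, sub_add_cancel] at h
  calc |g (p + v) + g (p - v) - 2 * g p| = |g (p + v) - g p - (g p - g (p - v))| := by ring_nf
    _ ≤ G₂ * ‖v‖ * ‖v‖ := h
    _ = G₂ * ‖v‖ ^ 2 := by ring

end Analysis

/-! ## §2 The second difference of the periodized bump on the torus -/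

section TorusSecondDiff

variable {dd : ℕ} {Ns Nc ℓ : ℕ} [NeZero Ns]

/-- (wrap dichotomy) for a site `x`, a cube `w` and a lattice vector `v`: either the minimal lifts of `x + v − cz w` and
`x − cz w` differ exactly by `v`, or in some coordinate both have absolute value `≥ N_s∕2 − |v_i|`. [folklore] -/
private theorem wrap_dichotomy (cz : TPt dd Nc → TPt dd Ns) (w : TPt dd Nc) (x : TPt dd Ns) (v : Pt dd) :
    (∀ i, ((x + proj Ns v - cz w) i).valMinAbs = ((x - cz w) i).valMinAbs + v i) ∨
    (∃ i, (Ns : ℝ) / 2 - |(v i : ℝ)| ≤ |(((x - cz w) i).valMinAbs : ℝ)| ∧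
      (Ns : ℝ) / 2 - |(v i : ℝ)| ≤ |(((x + proj Ns v - cz w) i).valMinAbs : ℝ)|) := by
  by_cases hcase : ∀ i, ((x + proj Ns v - cz w) i).valMinAbs = ((x - cz w) i).valMinAbs + v i
  · exact Or.inl hcase
  · right
    push Not at hcase
    obtain ⟨i, hi⟩ := hcase
    refine ⟨i, ?_⟩
    set a : ℤ := ((x - cz w) i).valMinAbs with ha
    set a' : ℤ := ((x + proj Ns v - cz w) i).valMinAbs with ha'
    have hcong : ((a' : ℤ) : ZMod Ns) = ((a + v i : ℤ) : ZMod Ns) := by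
      simp only [ha, ha', Int.cast_add, ZMod.coe_valMinAbs, Pi.sub_apply, Pi.add_apply, proj]
      ring
    obtain ⟨k, hk⟩ := (ZMod.intCast_eq_intCast_iff_dvd_sub _ _ _).1 hcong
    have hk0 : k ≠ 0 := by
      rintro rfl
      apply hi
      linarith
    have hNs1 : (Ns : ℤ) ≤ |a + v i - a'| := by
      rw [hk, abs_mul, Nat.abs_cast]
      have : 1 ≤ |k| := Int.one_le_abs hk0
      nlinarith [this, (Nat.cast_nonneg Ns : (0 : ℤ) ≤ Ns)]
    have hai : a.natAbs ≤ Ns / 2 := ZMod.natAbs_valMinAbs_le _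
    have ha'i : a'.natAbs ≤ Ns / 2 := ZMod.natAbs_valMinAbs_le _
    have rNs : (Ns : ℝ) ≤ |(a : ℝ) + v i - a'| := by
      have h1 : ((Ns : ℤ) : ℝ) ≤ (((|a + v i - a'| : ℤ)) : ℝ) := by exact_mod_cast hNs1
      rw [Int.cast_abs] at h1
      push_cast at h1 ⊢
      exact h1
    have rai : |(a : ℝ)| ≤ (Ns : ℝ) / 2 := by
      have h1 : (a.natAbs : ℝ) ≤ ((Ns / 2 : ℕ) : ℝ) := by exact_mod_cast hai
      rw [Nat.cast_natAbs, Int.cast_abs] at h1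
      exact h1.trans (Nat.cast_div_le.trans (by norm_num))
    have ra'i : |(a' : ℝ)| ≤ (Ns : ℝ) / 2 := by
      have h1 : (a'.natAbs : ℝ) ≤ ((Ns / 2 : ℕ) : ℝ) := by exact_mod_cast ha'i
      rw [Nat.cast_natAbs, Int.cast_abs] at h1
      exact h1.trans (Nat.cast_div_le.trans (by norm_num))
    have t1 := abs_add_le ((a : ℝ) + v i) (-(a' : ℝ))
    have t2 := abs_add_le (a : ℝ) (v i : ℝ)
    rw [← sub_eq_add_neg, abs_neg] at t1
    constructor
    · linarith
    · linarith

omit [NeZero Ns] in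
/-- (vanishing far out) if one coordinate of `b` is at least `N_s∕2 − 2` in absolute value and the support window stays two
sites clear of the antipode, the bump value `g(ℓ^{−1}b − t)` vanishes. [folklore] -/
private theorem g_eq_zero_of_far [NeZero ℓ] {t : ℝ} (hwin : (ℓ : ℝ) * (|t| + 3 / 5) + 2 < (Ns : ℝ) / 2)
    (b : Fin dd → ℤ) (i : Fin dd) (hb : (Ns : ℝ) / 2 - 2 ≤ |(b i : ℝ)|) :
    g (fun j => (ℓ : ℝ)⁻¹ * (b j : ℝ) - t) = 0 := by
  have hℓ : 0 < ℓ := Nat.pos_of_ne_zero (NeZero.ne ℓ)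
  have hℓr : (0 : ℝ) < ℓ := by exact_mod_cast hℓ
  apply g_eq_zero_of_coord (μ := i)
  have h1 : (ℓ : ℝ)⁻¹ * |(b i : ℝ)| - |t| ≤ |(ℓ : ℝ)⁻¹ * (b i : ℝ) - t| := by
    have := abs_sub_abs_le_abs_sub ((ℓ : ℝ)⁻¹ * (b i : ℝ)) t
    rw [abs_mul, abs_of_pos (inv_pos.2 hℓr)] at this
    exact this
  have h2 : |t| + 3 / 5 < (ℓ : ℝ)⁻¹ * ((Ns : ℝ) / 2 - 2) := by
    rw [lt_inv_mul_iff₀ hℓr]; linarith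
  have h3 : (ℓ : ℝ)⁻¹ * ((Ns : ℝ) / 2 - 2) ≤ (ℓ : ℝ)⁻¹ * |(b i : ℝ)| :=
    mul_le_mul_of_nonneg_left hb (inv_pos.2 hℓr).le
  linarith

/-- **«`(−Δh_□)(x)`» ON THE TORUS**: for the periodized bump `h_w(y) = g(ℓ^{−1}·valMinAbs(y − cz w) − t)` and a lattice
step `δ` with `|δ|_∞ ≤ 1`, `|h_w(x + δ) + h_w(x − δ) − 2h_w(x)| ≤ G₂ℓ^{−2}` (`g′` `G₂`-Lipschitz) — provided the support
window stays two sites clear of the antipode (`ℓ(|t| + 3∕5) + 2 < N_s∕2`): without wrap the three arguments are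
`p − u, p, p + u` with `‖u‖ ≤ ℓ^{−1}` (§1); at a wrap of a minimal lift all three values vanish.
[cite: Dimock2004QED3TorusII, §3.3 (201) p.30 L40–44 and §3.1 (124)–(126) p.20 L82 – p.21 L15] -/
theorem abs_second_diff_g_torus_le [NeZero ℓ] {t : ℝ} {G₂ : ℝ≥0}
    (hG₂ : LipschitzWith G₂ (fderiv ℝ (g : (Fin dd → ℝ) → ℝ)))
    (hwin : (ℓ : ℝ) * (|t| + 3 / 5) + 2 < (Ns : ℝ) / 2) (cz : TPt dd Nc → TPt dd Ns) (w : TPt dd Nc)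
    (x : TPt dd Ns) {δ : Pt dd} (hδ : δ ∈ box dd 1) :
    |g (fun i => (ℓ : ℝ)⁻¹ * (((x + proj Ns δ - cz w) i).valMinAbs : ℝ) - t)
        + g (fun i => (ℓ : ℝ)⁻¹ * (((x + proj Ns (-δ) - cz w) i).valMinAbs : ℝ) - t)
        - 2 * g (fun i => (ℓ : ℝ)⁻¹ * (((x - cz w) i).valMinAbs : ℝ) - t)| ≤ (G₂ : ℝ) * ((ℓ : ℝ)⁻¹) ^ 2 := by
  have hℓ : 0 < ℓ := Nat.pos_of_ne_zero (NeZero.ne ℓ)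
  have hℓr : (0 : ℝ) < ℓ := by exact_mod_cast hℓ
  have hG0 : 0 ≤ (G₂ : ℝ) := G₂.coe_nonneg
  have hδ1 : ∀ i, |(δ i : ℝ)| ≤ 1 := fun i => by
    have h := mem_box.1 hδ i
    have h' : |δ i| ≤ 1 := abs_le.2 ⟨by omega, by omega⟩
    rw [← Int.cast_abs]
    exact_mod_cast h'
  have hδ1' : ∀ i, |((-δ) i : ℝ)| ≤ 1 := fun i => by
    rw [Pi.neg_apply, Int.cast_neg, abs_neg]; exact hδ1 i
  -- the three values, abbreviated
  have van0 : ∀ i, (Ns : ℝ) / 2 - 2 ≤ |((((x - cz w) i).valMinAbs : ℤ) : ℝ)| →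
      g (fun j => (ℓ : ℝ)⁻¹ * (((x - cz w) j).valMinAbs : ℝ) - t) = 0 :=
    fun i hi => g_eq_zero_of_far (ℓ := ℓ) hwin (fun j => ((x - cz w) j).valMinAbs) i hi
  have vanp : ∀ i, (Ns : ℝ) / 2 - 2 ≤ |((((x + proj Ns δ - cz w) i).valMinAbs : ℤ) : ℝ)| →
      g (fun j => (ℓ : ℝ)⁻¹ * (((x + proj Ns δ - cz w) j).valMinAbs : ℝ) - t) = 0 :=
    fun i hi => g_eq_zero_of_far (ℓ := ℓ) hwin (fun j => ((x + proj Ns δ - cz w) j).valMinAbs) i hi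
  have vanm : ∀ i, (Ns : ℝ) / 2 - 2 ≤ |((((x + proj Ns (-δ) - cz w) i).valMinAbs : ℤ) : ℝ)| →
      g (fun j => (ℓ : ℝ)⁻¹ * (((x + proj Ns (-δ) - cz w) j).valMinAbs : ℝ) - t) = 0 :=
    fun i hi => g_eq_zero_of_far (ℓ := ℓ) hwin (fun j => ((x + proj Ns (-δ) - cz w) j).valMinAbs) i hi
  rcases wrap_dichotomy cz w x δ with hp | ⟨i, hi1, hi2⟩
  · rcases wrap_dichotomy cz w x (-δ) with hm | ⟨j, hj1, hj2⟩
    · -- no wrap: a genuine second difference with step `u = ℓ⁻¹δ`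
      have e1 : (fun i => (ℓ : ℝ)⁻¹ * (((x + proj Ns δ - cz w) i).valMinAbs : ℝ) - t)
          = (fun i => (ℓ : ℝ)⁻¹ * (((x - cz w) i).valMinAbs : ℝ) - t) + (fun i => (ℓ : ℝ)⁻¹ * (δ i : ℝ)) := by
        funext i
        rw [hp i]
        simp only [Pi.add_apply]
        push_cast
        ring
      have e2 : (fun i => (ℓ : ℝ)⁻¹ * (((x + proj Ns (-δ) - cz w) i).valMinAbs : ℝ) - t)
          = (fun i => (ℓ : ℝ)⁻¹ * (((x - cz w) i).valMinAbs : ℝ) - t) - (fun i => (ℓ : ℝ)⁻¹ * (δ i : ℝ)) := by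
        funext i
        rw [hm i]
        simp only [Pi.sub_apply, Pi.neg_apply]
        push_cast
        ring
      have hu : ‖(fun i => (ℓ : ℝ)⁻¹ * (δ i : ℝ))‖ ≤ (ℓ : ℝ)⁻¹ := by
        refine (pi_norm_le_iff_of_nonneg (inv_pos.2 hℓr).le).2 fun i => ?_
        rw [Real.norm_eq_abs, abs_mul, abs_of_pos (inv_pos.2 hℓr)]
        exact mul_le_of_le_one_right (inv_pos.2 hℓr).le (hδ1 i)
      rw [e1, e2]
      refine (abs_g_second_diff_le hG₂ _ _).trans ?_
      exact mul_le_mul_of_nonneg_left (pow_le_pow_left₀ (norm_nonneg _) hu 2) hG0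
    · -- a wrap between `x` and `x − δ`: all three values vanish
      have h0 : g (fun j => (ℓ : ℝ)⁻¹ * (((x - cz w) j).valMinAbs : ℝ) - t) = 0 :=
        van0 j (by linarith [hδ1' j])
      have hm0 : g (fun j => (ℓ : ℝ)⁻¹ * (((x + proj Ns (-δ) - cz w) j).valMinAbs : ℝ) - t) = 0 :=
        vanm j (by linarith [hδ1' j])
      have hp0 : g (fun j => (ℓ : ℝ)⁻¹ * (((x + proj Ns δ - cz w) j).valMinAbs : ℝ) - t) = 0 := by
        refine vanp j ?_
        rw [hp j, Int.cast_add]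
        have := abs_add_le ((((x - cz w) j).valMinAbs : ℝ) + δ j) (-(δ j : ℝ))
        rw [add_neg_cancel_right, abs_neg] at this
        linarith [hδ1 j, hδ1' j]
      rw [h0, hm0, hp0]
      norm_num
      positivity
  · -- a wrap between `x` and `x + δ`: all three values vanish
    have h0 : g (fun j => (ℓ : ℝ)⁻¹ * (((x - cz w) j).valMinAbs : ℝ) - t) = 0 :=
      van0 i (by linarith [hδ1 i])
    have hp0 : g (fun j => (ℓ : ℝ)⁻¹ * (((x + proj Ns δ - cz w) j).valMinAbs : ℝ) - t) = 0 :=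
      vanp i (by linarith [hδ1 i])
    have hm0 : g (fun j => (ℓ : ℝ)⁻¹ * (((x + proj Ns (-δ) - cz w) j).valMinAbs : ℝ) - t) = 0 := by
      rcases wrap_dichotomy cz w x (-δ) with hm | ⟨j, hj1, hj2⟩
      · refine vanm i ?_
        rw [hm i, Int.cast_add]
        have := abs_add_le ((((x - cz w) i).valMinAbs : ℝ) + (-δ) i) (-((-δ) i : ℝ))
        rw [add_neg_cancel_right, abs_neg] at this
        linarith [hδ1 i, hδ1' i]
      · exact vanm j (by linarith [hδ1' j])
    rw [h0, hm0, hp0]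
    norm_num
    positivity

end TorusSecondDiff

/-! ## §3 «we use (129)» at `α = 1`, without losing decay -/

section BlockSumOne

variable {X : Type*} [Fintype X] {Ns Nb ℓb : ℕ} [NeZero Ns] [NeZero ℓb]

/-- **«`d′(x′,y) ≥ d′(x,y)∕2`» ⟹ `d′(x′,y)^{−1} ≤ 2d′(x,y)^{−1}`** (real powers). [cite: Dimock2004QED3TorusII, §3.2 Thm 1 proof Part II p.23 L68] -/
theorem rpow_neg_one_le_two_mul {a b : ℝ} (ha : 0 < a) (hb : 0 < b) (hab : b ≤ 2 * a) :
    a ^ (-(1 : ℝ)) ≤ 2 * b ^ (-(1 : ℝ)) := by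
  rw [Real.rpow_neg_one, Real.rpow_neg_one, ← div_eq_mul_inv, le_div_iff₀ hb, inv_mul_le_iff₀ ha]
  linarith

/-- **The block integral at `α = 1` compared with `d′(x,v)^{−1}`** (the boson analogue of `sum_block_dprimeT_le`):
`Σ_{u : Δ_u = Δ_x}η³d′_T(e u,e v)^{−1} ≤ (2(ηR)³ + 2C(1)(ηR)²(ηℓ_b))·d′_T(e x,e v)^{−1}` — two cases: `d′_T(e x,e v) ≥ 2ηℓ_b`
(comparability on the block) or `< 2ηℓ_b` (LEMMA 1 (129) on the torus at `α = 1` and `1 ≤ 2ηℓ_b·d′^{−1}`).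
[cite: Dimock2004QED3TorusII, §3.3 (201)–(202) p.30 L40–50 («by (129)») and §3.1 Lemma 1 (129) p.21 L36–39] -/
theorem sum_block_dprimeT_one_le (hmodS : Ns = ℓb * Nb) (e : X → TPt 3 Ns) (he : Function.Injective e)
    (β : X → TPt 3 Nb) (hβ : ∀ x, β x = czmap ℓb Nb (e x)) {η : ℝ} (hη : 0 < η) {R : ℕ} (hR : 1 ≤ R)
    (hblk : ∀ b, (univ.filter fun u => β u = b).card ≤ R ^ 3) (x v : X) :
    ∑ u ∈ univ.filter (fun u => β u = β x), η ^ 3 * (η * dOne (vmaVec (e u - e v))) ^ (-(1 : ℝ))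
      ≤ (2 * (η * R) ^ 3 + 2 * blockConst 1 * (η * R) ^ 2 * (η * ℓb))
          * (η * dOne (vmaVec (e x - e v))) ^ (-(1 : ℝ)) := by
  set F : Finset X := univ.filter fun u => β u = β x
  have hℓb : 0 < ℓb := Nat.pos_of_ne_zero (NeZero.ne ℓb)
  have hℓbr : (1 : ℝ) ≤ ℓb := by exact_mod_cast hℓb
  have hdxv := dprimeT_pos hη (e x) (e v)
  have hd1 : 0 < dOne (vmaVec (e x - e v)) := dOne_pos _
  have hC1 : 0 ≤ blockConst 1 := zero_le_one.trans (one_le_blockConst (α := 1) (by norm_num))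
  have hA : 0 ≤ 2 * (η * R) ^ 3 * (η * dOne (vmaVec (e x - e v))) ^ (-(1 : ℝ)) := by positivity
  have hB : 0 ≤ 2 * blockConst 1 * (η * R) ^ 2 * (η * ℓb) * (η * dOne (vmaVec (e x - e v))) ^ (-(1 : ℝ)) := by
    positivity
  have hcardF : (F.card : ℝ) ≤ (R : ℝ) ^ 3 := by exact_mod_cast hblk (β x)
  by_cases hcase : 2 * (η * ℓb) ≤ η * dOne (vmaVec (e x - e v))
  · have hterm : ∀ u ∈ F, η ^ 3 * (η * dOne (vmaVec (e u - e v))) ^ (-(1 : ℝ))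
        ≤ η ^ 3 * (2 * (η * dOne (vmaVec (e x - e v))) ^ (-(1 : ℝ))) := by
      intro u hu
      have hux : β u = β x := (mem_filter.1 hu).2
      have hmem : e u ∈ tball (e x) (ℓb - 1) := by
        refine mem_tball_of_czmap_eq (Ls := ℓb) (Nc := Nb) hmodS ?_
        rw [← hβ, ← hβ]
        exact hux
      have h1 : dOne (vmaVec (e x - e u)) ≤ ℓb := by
        have hs := supN_vmaVec_sub_le_of_mem_tball hmem
        have hs' : (supN (vmaVec (e x - e u)) : ℝ) ≤ ℓb := by
          have h' : ((ℓb - 1 : ℕ) : ℝ) ≤ ℓb := by exact_mod_cast Nat.sub_le ℓb 1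
          exact le_trans (by exact_mod_cast hs) h'
        unfold dOne
        exact max_le hℓbr hs'
      have htri := dprimeT_triangle hη.le (e x) (e u) (e v)
      have h2 : η * dOne (vmaVec (e x - e u)) ≤ η * ℓb := mul_le_mul_of_nonneg_left h1 hη.le
      refine mul_le_mul_of_nonneg_left ?_ (pow_nonneg hη.le 3)
      exact rpow_neg_one_le_two_mul (dprimeT_pos hη (e u) (e v)) hdxv (by linarith)
    calc ∑ u ∈ F, η ^ 3 * (η * dOne (vmaVec (e u - e v))) ^ (-(1 : ℝ))
        ≤ ∑ u ∈ F, η ^ 3 * (2 * (η * dOne (vmaVec (e x - e v))) ^ (-(1 : ℝ))) := sum_le_sum hterm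
      _ = F.card * (η ^ 3 * (2 * (η * dOne (vmaVec (e x - e v))) ^ (-(1 : ℝ)))) := by
          rw [sum_const, nsmul_eq_mul]
      _ ≤ (R : ℝ) ^ 3 * (η ^ 3 * (2 * (η * dOne (vmaVec (e x - e v))) ^ (-(1 : ℝ)))) :=
          mul_le_mul_of_nonneg_right hcardF (by positivity)
      _ = 2 * (η * R) ^ 3 * (η * dOne (vmaVec (e x - e v))) ^ (-(1 : ℝ)) := by ring
      _ ≤ _ := by rw [add_mul]; linarith
  · rw [not_le] at hcase
    have hinj : ∀ y ∈ F, ∀ y' ∈ F, e y = e y' → y = y' := fun y _ y' _ h => he h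
    have hcard : (F.image e).card ≤ R ^ 3 := card_image_le.trans (hblk (β x))
    have h129 := eq129_torus (α := 1) (by norm_num) (by norm_num) hη (F.image e) hR hcard (e v)
    rw [sum_image hinj, show (3 : ℝ) - 1 = 2 by norm_num, Real.rpow_two] at h129
    have hsum : ∑ u ∈ F, η ^ 3 * (η * dOne (vmaVec (e u - e v))) ^ (-(1 : ℝ))
        = ∑ u ∈ F, η ^ 3 * (η * dOne (vmaVec (e v - e u))) ^ (-(1 : ℝ)) :=
      sum_congr rfl fun u _ => by rw [dOne_vmaVec_sub_comm]
    rw [hsum]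
    refine h129.trans ?_
    have hone : (1 : ℝ) ≤ (2 * (η * ℓb)) * (η * dOne (vmaVec (e x - e v))) ^ (-(1 : ℝ)) := by
      rw [Real.rpow_neg_one, ← div_eq_mul_inv, le_div_iff₀ hdxv, one_mul]
      exact hcase.le
    calc blockConst 1 * (η * R) ^ 2 = blockConst 1 * (η * R) ^ 2 * 1 := (mul_one _).symm
      _ ≤ blockConst 1 * (η * R) ^ 2 * ((2 * (η * ℓb)) * (η * dOne (vmaVec (e x - e v))) ^ (-(1 : ℝ))) :=
          mul_le_mul_of_nonneg_left hone (by positivity)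
      _ = 2 * blockConst 1 * (η * R) ^ 2 * (η * ℓb) * (η * dOne (vmaVec (e x - e v))) ^ (-(1 : ℝ)) := by ring
      _ ≤ _ := by rw [add_mul]; linarith

end BlockSumOne

/-! ## §4 (200)–(201) ⟹ the boson later-link bound, on the torus -/

section PartII

variable {X : Type*} [Fintype X] [DecidableEq X]
variable {E : Type*} [NormedRing E] [NormedAlgebra ℝ E] [NormOneClass E]
variable {Z : Type*}

/-- **the later link split along `R_□ = R^Δ_□ + R^Q_□`** ((200)–(201)): for central `h_□` with `|h_□| ≤ 1` and `A` with
off-diagonal entries `A_Δ(x,u) + A_Q(x,u)`,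
`‖(R_□G*_□h_□)(x,v)‖ ≤ ‖Σ_u(h_□(x) − h_□(u))A_Δ(x,u)G*_□(u,v)‖ + Σ_u|h_□(x) − h_□(u)|‖A_Q(x,u)‖‖G*_□(u,v)‖` — the Laplacian sum is
kept whole (its bound needs a cancellation), the averaging sum is taken termwise.
[cite: Dimock2004QED3TorusII, §3.3 (199)–(201) p.30 L24–45] -/
theorem norm_linkR_le_split (f : Z → X → ℝ) {H : Z → Matrix X X E}
    (hH : ∀ z, H z = Matrix.diagonal fun x => algebraMap ℝ E (f z x)) (hf1 : ∀ z x, |f z x| ≤ 1)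
    (A AD AQ : Matrix X X E) (hA : ∀ x u, x ≠ u → A x u = AD x u + AQ x u) (G : Z → Matrix X X E)
    (z : Z) (x v : X) :
    ‖linkR A H G z x v‖ ≤ ‖∑ u, (f z x - f z u) • AD x u * G z u v‖
      + ∑ u, |f z x - f z u| * ‖AQ x u‖ * ‖G z u v‖ := by
  have happ := linkR_apply (φ := fun z x => algebraMap ℝ E (f z x)) hH A G z x v
  beta_reduce at happ
  rw [happ]
  have hφ : ∀ y, ‖algebraMap ℝ E (f z y)‖ ≤ 1 := fun y => by
    rw [norm_algebraMap', Real.norm_eq_abs]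
    exact hf1 z y
  have hK : ∀ u, algebraMap ℝ E (f z x) * A x u - A x u * algebraMap ℝ E (f z u) = (f z x - f z u) • A x u := by
    intro u
    rw [Algebra.smul_def, map_sub, sub_mul, Algebra.commutes (f z u) (A x u)]
  simp_rw [hK]
  have hsplit : ∑ u, (f z x - f z u) • A x u * G z u v
      = ∑ u, (f z x - f z u) • AD x u * G z u v + ∑ u, (f z x - f z u) • AQ x u * G z u v := by
    rw [← sum_add_distrib]
    refine sum_congr rfl fun u _ => ?_
    by_cases hxu : x = u
    · subst hxu
      simp
    · rw [hA x u hxu, smul_add, add_mul]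
  rw [hsplit]
  calc ‖(∑ u, (f z x - f z u) • AD x u * G z u v + ∑ u, (f z x - f z u) • AQ x u * G z u v)
          * algebraMap ℝ E (f z v)‖
      ≤ ‖∑ u, (f z x - f z u) • AD x u * G z u v + ∑ u, (f z x - f z u) • AQ x u * G z u v‖
          * ‖algebraMap ℝ E (f z v)‖ := norm_mul_le _ _
    _ ≤ ‖∑ u, (f z x - f z u) • AD x u * G z u v + ∑ u, (f z x - f z u) • AQ x u * G z u v‖ * 1 :=
        mul_le_mul_of_nonneg_left (hφ v) (norm_nonneg _)
    _ ≤ ‖∑ u, (f z x - f z u) • AD x u * G z u v‖ + ‖∑ u, (f z x - f z u) • AQ x u * G z u v‖ := by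
        rw [mul_one]
        exact norm_add_le _ _
    _ ≤ ‖∑ u, (f z x - f z u) • AD x u * G z u v‖ + ∑ u, ‖(f z x - f z u) • AQ x u * G z u v‖ := by
        gcongr
        exact norm_sum_le _ _
    _ ≤ _ := by
        gcongr with u
        refine (norm_mul_le _ _).trans ?_
        rw [norm_smul, Real.norm_eq_abs]

omit [NormedAlgebra ℝ E] [NormOneClass E] [DecidableEq X] in
/-- **the Laplacian commutator sum, rearranged exactly**: if `A_Δ` acts as
`(A_Δf)(x) = c_Δ·Σ_μ(f(x + e_μ) + f(x − e_μ) − 2f(x))` (for `−Δ`: `c_Δ = −η^{−2}`), then for every multiplication operator `h`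
`Σ_u(h(x) − h(u))A_Δ(x,u)S(u) = c_Δ·Σ_μ[(h(x) − h(x + e_μ))S(x + e_μ) + (h(x) − h(x − e_μ))S(x − e_μ)]` — the diagonal drops out;
this is the lattice form of the printed `(−Δh_□)G* + (∂h_□)∂G* + (∂ᵀh_□)∂ᵀG*` before the symmetric ∕ antisymmetric split.
[cite: Dimock2004QED3TorusII, §3.3 (200)–(201) p.30 L36–44] -/
theorem laplacian_comm_sum_eq {E : Type*} [Ring E] [Module ℝ E] [IsScalarTower ℝ E E] [SMulCommClass ℝ E E]
    (h : X → ℝ) (AD : Matrix X X E) (nbp nbm : Fin 3 → X → X) {cΔ : ℝ}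
    (hAD : ∀ (S : X → E) (x : X), ∑ u, AD x u * S u = cΔ • ∑ μ, (S (nbp μ x) + S (nbm μ x) - (2 : ℝ) • S x))
    (S : X → E) (x : X) :
    ∑ u, (h x - h u) • AD x u * S u
      = cΔ • ∑ μ, ((h x - h (nbp μ x)) • S (nbp μ x) + (h x - h (nbm μ x)) • S (nbm μ x)) := by
  have hterm : ∀ u, (h x - h u) • AD x u * S u = h x • (AD x u * S u) - AD x u * (h u • S u) := by
    intro u
    rw [sub_smul, sub_mul, smul_mul_assoc, smul_mul_assoc, mul_smul_comm]
  simp_rw [hterm]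
  rw [sum_sub_distrib, ← smul_sum, hAD S x, hAD (fun u => h u • S u) x, smul_comm (h x) cΔ, ← smul_sub]
  congr 1
  rw [smul_sum, ← sum_sub_distrib]
  refine sum_congr rfl fun μ _ => ?_
  module

variable {Ns Nb Nc M₀ ℓb : ℕ} [NeZero Ns] [NeZero Nb] [NeZero Nc] [NeZero M₀] [NeZero ℓb]

omit [DecidableEq X] [NormOneClass E] [NeZero Nc] in
/-- **(201) for the Laplacian part, on the torus.**  With `h_w := ` the periodized (124) (`ℓ = ℓ_bM₀` sites per cube side;
window `ℓ(|t| + 3∕5) + 2 < N_s∕2`), neighbour maps `x ↦ x ± e_μ` (`e(x ± e_μ) = e x ± e_μ` on the site torus), `A_Δ` acting as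
`−Δ = −η^{−2}Σ_μ(f(x+e_μ) + f(x−e_μ) − 2f(x))` and LEMMA 3 (198) for `G*_□ = G_w` (value bound with `C₀`, forward-gradient
bound with `C₀′`): `‖Σ_u(h_w(x) − h_w(u))A_Δ(x,u)G_w(u,v)‖ ≤ C_Δ∕M₀ · η³(d′_T^{−1} + d′_T^{−2})(e x,e v)e^{−c·d(Δ_x,Δ_v)}` with
`C_Δ = 3e^{6c}(4G₂C₀(ηℓ_b)^{−2} + 5GC₀′(ηℓ_b)^{−1})` — by `laplacian_comm_sum_eq` and, per direction, the split
`aS₊ + bS₋ = ½(a + b)(S₊ + S₋) + ½(a − b)(S₊ − S₋)`: `|a + b| = |h_w(x+e_μ) + h_w(x−e_μ) − 2h_w(x)| ≤ G₂ℓ^{−2}` («`(−Δh_□)(x)`»,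
`abs_second_diff_g_torus_le`), `|a − b| = |h_w(x−e_μ) − h_w(x+e_μ)| ≤ 2Gℓ^{−1}` («`∂h_□`», (145) on the torus), `‖S_±‖` by the
value bound (hop comparability `e^{6c}`, factor `4`), `‖S₊ − S₋‖` by the GRADIENT bound at `x` and at `x − e_μ` («`∂G*_□`»).
[cite: Dimock2004QED3TorusII, §3.3 (201) p.30 L38–44, Lemma 3 (198) p.30 L19–22; §3.2 (145) p.23 L66–69] -/
theorem sum_laplacian_part_le {c η t Gg C₀ C₀' : ℝ} {G₂ : ℝ≥0} (hmodS : Ns = ℓb * Nb) (e : X → TPt 3 Ns)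
    (he : Function.Injective e) (β : X → TPt 3 Nb) (hβ : ∀ x, β x = czmap ℓb Nb (e x)) (hη : 0 < η) (hc : 0 ≤ c)
    (hGg : ∀ z : Fin 3 → ℝ, ‖fderiv ℝ (g : (Fin 3 → ℝ) → ℝ) z‖ ≤ Gg)
    (hG₂ : LipschitzWith G₂ (fderiv ℝ (g : (Fin 3 → ℝ) → ℝ)))
    (hwin : (((ℓb * M₀ : ℕ)) : ℝ) * (|t| + 3 / 5) + 2 < (Ns : ℝ) / 2)
    (cz : TPt 3 Nc → TPt 3 Ns) (w : TPt 3 Nc)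
    (nbp nbm : Fin 3 → X → X) (hnbp : ∀ μ x, e (nbp μ x) = e x + proj Ns (Pi.single μ 1))
    (hnbm : ∀ μ x, e (nbm μ x) = e x + proj Ns (-Pi.single μ 1))
    (AD : Matrix X X E)
    (hAD : ∀ (S : X → E) (x : X), ∑ u, AD x u * S u
      = (-(η⁻¹ ^ 2)) • ∑ μ, (S (nbp μ x) + S (nbm μ x) - (2 : ℝ) • S x))
    (Gw : Matrix X X E) (hC₀ : 0 ≤ C₀) (hC₀' : 0 ≤ C₀')
    (h198a : ∀ u v, ‖Gw u v‖ ≤ C₀ * ((η ^ 3 * (η * dOne (vmaVec (e u - e v))) ^ (-(1 : ℝ)))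
      * Real.exp (-(c * torusDist (β u) (β v)))))
    (h198b : ∀ x μ v, ‖Gw (nbp μ x) v - Gw x v‖ ≤ C₀' * (η * ((η ^ 3 *
      ((η * dOne (vmaVec (e x - e v))) ^ (-(1 : ℝ)) + (η * dOne (vmaVec (e x - e v))) ^ (-(2 : ℝ))))
        * Real.exp (-(c * torusDist (β x) (β v))))))
    (x v : X) :
    ‖∑ u, (g (fun i => (((ℓb * M₀ : ℕ) : ℝ))⁻¹ * (((e x - cz w) i).valMinAbs : ℝ) - t)
          - g (fun i => (((ℓb * M₀ : ℕ) : ℝ))⁻¹ * (((e u - cz w) i).valMinAbs : ℝ) - t)) • AD x u * Gw u v‖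
      ≤ (3 * Real.exp (c * 6) * (4 * G₂ * C₀ * ((η * ℓb) ^ 2)⁻¹ + 5 * Gg * C₀' * (η * ℓb)⁻¹)) / (M₀ : ℝ)
        * ((η ^ 3 * ((η * dOne (vmaVec (e x - e v))) ^ (-(1 : ℝ)) + (η * dOne (vmaVec (e x - e v))) ^ (-(2 : ℝ))))
          * Real.exp (-(c * torusDist (β x) (β v)))) := by
  haveI : NeZero (ℓb * M₀) := ⟨Nat.mul_ne_zero (NeZero.ne ℓb) (NeZero.ne M₀)⟩
  have hℓb : 0 < ℓb := Nat.pos_of_ne_zero (NeZero.ne ℓb)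
  have hM₀ : 0 < M₀ := Nat.pos_of_ne_zero (NeZero.ne M₀)
  have hℓbr : (0 : ℝ) < ℓb := by exact_mod_cast hℓb
  have hM₀r : (1 : ℝ) ≤ M₀ := by exact_mod_cast hM₀
  have hGg0 : 0 ≤ Gg := (norm_nonneg _).trans (hGg 0)
  have hG20 : 0 ≤ (G₂ : ℝ) := G₂.coe_nonneg
  have hℓ : (((ℓb * M₀ : ℕ)) : ℝ) = (ℓb : ℝ) * M₀ := by push_cast; ring
  have hℓpos : (0 : ℝ) < ((ℓb * M₀ : ℕ) : ℝ) := by rw [hℓ]; positivity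
  -- abbreviations: the bump, the two profiles
  set f : X → ℝ := fun y => g (fun i => (((ℓb * M₀ : ℕ) : ℝ))⁻¹ * (((e y - cz w) i).valMinAbs : ℝ) - t) with hf
  set Φ₁ : X → ℝ := fun y => (η ^ 3 * (η * dOne (vmaVec (e y - e v))) ^ (-(1 : ℝ)))
    * Real.exp (-(c * torusDist (β y) (β v))) with hΦ₁
  set Φ : X → ℝ := fun y => (η ^ 3 * ((η * dOne (vmaVec (e y - e v))) ^ (-(1 : ℝ))
    + (η * dOne (vmaVec (e y - e v))) ^ (-(2 : ℝ)))) * Real.exp (-(c * torusDist (β y) (β v))) with hΦ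
  have hd : ∀ y, 0 < η * dOne (vmaVec (e y - e v)) := fun y => dprimeT_pos hη (e y) (e v)
  have hΦ₁0 : ∀ y, 0 ≤ Φ₁ y := fun y =>
    mul_nonneg (mul_nonneg (pow_nonneg hη.le 3) (Real.rpow_nonneg (hd y).le _)) (Real.exp_pos _).le
  have hΦ0 : ∀ y, 0 ≤ Φ y := fun y =>
    mul_nonneg (mul_nonneg (pow_nonneg hη.le 3) (add_nonneg (Real.rpow_nonneg (hd y).le _)
      (Real.rpow_nonneg (hd y).le _))) (Real.exp_pos _).le
  have hΦ₁Φ : ∀ y, Φ₁ y ≤ Φ y := fun y => by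
    simp only [hΦ₁, hΦ]
    have h2 : 0 ≤ (η * dOne (vmaVec (e y - e v))) ^ (-(2 : ℝ)) := Real.rpow_nonneg (hd y).le _
    have hη3 : 0 ≤ η ^ 3 := pow_nonneg hη.le 3
    have hex : 0 ≤ Real.exp (-(c * torusDist (β y) (β v))) := (Real.exp_pos _).le
    have hsplit : (η ^ 3 * ((η * dOne (vmaVec (e y - e v))) ^ (-(1 : ℝ))
        + (η * dOne (vmaVec (e y - e v))) ^ (-(2 : ℝ)))) * Real.exp (-(c * torusDist (β y) (β v)))
        = (η ^ 3 * (η * dOne (vmaVec (e y - e v))) ^ (-(1 : ℝ))) * Real.exp (-(c * torusDist (β y) (β v)))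
          + (η ^ 3 * (η * dOne (vmaVec (e y - e v))) ^ (-(2 : ℝ))) * Real.exp (-(c * torusDist (β y) (β v))) := by
      ring
    rw [hsplit]
    linarith [mul_nonneg (mul_nonneg hη3 h2) hex]
  -- unit steps are box vectors
  have hδbox : ∀ μ : Fin 3, (Pi.single μ 1 : Pt 3) ∈ box 3 1 := fun μ =>
    mem_box.2 fun i => by by_cases hi : i = μ <;> simp [hi]
  have hδbox' : ∀ μ : Fin 3, (-Pi.single μ 1 : Pt 3) ∈ box 3 1 := fun μ =>
    mem_box.2 fun i => by by_cases hi : i = μ <;> simp [hi]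
  have hδδbox : ∀ μ : Fin 3, (Pi.single μ 1 + Pi.single μ 1 : Pt 3) ∈ box 3 2 := fun μ =>
    mem_box.2 fun i => by by_cases hi : i = μ <;> simp [hi]
  -- neighbours are in the unit sup-ball; `x = (x − e_μ) + e_μ`
  have hnbp1 : ∀ μ y, e (nbp μ y) ∈ tball (e y) 1 := fun μ y => mem_tball.2 ⟨_, hδbox μ, hnbp μ y⟩
  have hnbm1 : ∀ μ y, e (nbm μ y) ∈ tball (e y) 1 := fun μ y => mem_tball.2 ⟨_, hδbox' μ, hnbm μ y⟩
  have hinv : ∀ μ y, nbp μ (nbm μ y) = y := by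
    intro μ y
    apply he
    rw [hnbp, hnbm, add_assoc, ← proj_add, neg_add_cancel]
    have : proj Ns (0 : Pt 3) = 0 := by funext i; simp [proj]
    rw [this, add_zero]
  have hpm2 : ∀ μ y, e (nbp μ y) ∈ tball (e (nbm μ y)) 2 := by
    intro μ y
    refine mem_tball.2 ⟨_, hδδbox μ, ?_⟩
    rw [hnbp, hnbm, add_assoc, ← proj_add, neg_add_cancel_left]
  -- comparability across one hop: value bound and the profile `Φ`
  have hop : ∀ y, e y ∈ tball (e x) 1 →
      ‖Gw y v‖ ≤ C₀ * (4 * Real.exp (c * 6) * Φ₁ x) ∧ Φ y ≤ 4 * Real.exp (c * 6) * Φ x := by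
    intro y hy
    have hβy : β y ∈ tball (β x) 2 := by
      have h1 := czmap_mem_tball (Ls := ℓb) (Nc := Nb) hmodS hy
      rw [← hβ, ← hβ] at h1
      exact tball_mono (by have := Nat.div_le_self 1 ℓb; omega) h1
    have hdist : torusDist (β x) (β v) - 6 ≤ torusDist (β y) (β v) := by
      have h1 := torusDist_le_of_mem_tball hβy
      have h2 := torusDist_triangle (β x) (β y) (β v)
      norm_num at h1
      linarith
    have hd1 : dOne (vmaVec (e x - e y)) ≤ (1 : ℕ) := dOne_vmaVec_sub_le_of_mem_tball hy le_rfl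
    rw [Nat.cast_one] at hd1
    have htri := dprimeT_triangle hη.le (e x) (e y) (e v)
    have hone := one_le_dOne (vmaVec (e y - e v))
    have hxy : η * dOne (vmaVec (e x - e y)) ≤ η * 1 := mul_le_mul_of_nonneg_left hd1 hη.le
    have hyv : η * 1 ≤ η * dOne (vmaVec (e y - e v)) := mul_le_mul_of_nonneg_left hone hη.le
    have hab : η * dOne (vmaVec (e x - e v)) ≤ 2 * (η * dOne (vmaVec (e y - e v))) := by linarith
    have r1 := rpow_neg_one_le_two_mul (hd y) (hd x) hab
    have r2 := rpow_neg_two_le_four_mul (hd y) (hd x) hab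
    have p1 : 0 ≤ (η * dOne (vmaVec (e x - e v))) ^ (-(1 : ℝ)) := Real.rpow_nonneg (hd x).le _
    have hη3 : 0 ≤ η ^ 3 := pow_nonneg hη.le 3
    have hP1 : η ^ 3 * (η * dOne (vmaVec (e y - e v))) ^ (-(1 : ℝ))
        ≤ 4 * (η ^ 3 * (η * dOne (vmaVec (e x - e v))) ^ (-(1 : ℝ))) := by
      calc η ^ 3 * (η * dOne (vmaVec (e y - e v))) ^ (-(1 : ℝ))
          ≤ η ^ 3 * (2 * (η * dOne (vmaVec (e x - e v))) ^ (-(1 : ℝ))) := mul_le_mul_of_nonneg_left r1 hη3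
        _ = 4 * (η ^ 3 * (η * dOne (vmaVec (e x - e v))) ^ (-(1 : ℝ)))
            - 2 * (η ^ 3 * (η * dOne (vmaVec (e x - e v))) ^ (-(1 : ℝ))) := by ring
        _ ≤ _ := by linarith [mul_nonneg hη3 p1]
    have hP : η ^ 3 * ((η * dOne (vmaVec (e y - e v))) ^ (-(1 : ℝ)) + (η * dOne (vmaVec (e y - e v))) ^ (-(2 : ℝ)))
        ≤ 4 * (η ^ 3 * ((η * dOne (vmaVec (e x - e v))) ^ (-(1 : ℝ))
          + (η * dOne (vmaVec (e x - e v))) ^ (-(2 : ℝ)))) := by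
      calc η ^ 3 * ((η * dOne (vmaVec (e y - e v))) ^ (-(1 : ℝ)) + (η * dOne (vmaVec (e y - e v))) ^ (-(2 : ℝ)))
          ≤ η ^ 3 * (2 * (η * dOne (vmaVec (e x - e v))) ^ (-(1 : ℝ))
              + 4 * (η * dOne (vmaVec (e x - e v))) ^ (-(2 : ℝ))) :=
            mul_le_mul_of_nonneg_left (add_le_add r1 r2) hη3
        _ = 4 * (η ^ 3 * ((η * dOne (vmaVec (e x - e v))) ^ (-(1 : ℝ))
              + (η * dOne (vmaVec (e x - e v))) ^ (-(2 : ℝ))))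
            - 2 * (η ^ 3 * (η * dOne (vmaVec (e x - e v))) ^ (-(1 : ℝ))) := by ring
        _ ≤ _ := by linarith [mul_nonneg hη3 p1]
    constructor
    · have hprof := profile_hop_le (P := fun u v => η ^ 3 * (η * dOne (vmaVec (e u - e v))) ^ (-(1 : ℝ)))
        (d := fun u v => torusDist (β u) (β v)) (c := c) (δ := 6) hc
        (fun u v => mul_nonneg (pow_nonneg hη.le 3) (Real.rpow_nonneg (dprimeT_pos hη (e u) (e v)).le _))
        (x := x) (x' := y) (y := v) hP1 hdist
      exact (h198a y v).trans (mul_le_mul_of_nonneg_left hprof hC₀)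
    · exact profile_hop_le (P := fun u v => η ^ 3 * ((η * dOne (vmaVec (e u - e v))) ^ (-(1 : ℝ))
          + (η * dOne (vmaVec (e u - e v))) ^ (-(2 : ℝ))))
        (d := fun u v => torusDist (β u) (β v)) (c := c) (δ := 6) hc
        (fun u v => mul_nonneg (pow_nonneg hη.le 3) (add_nonneg (Real.rpow_nonneg (dprimeT_pos hη (e u) (e v)).le _)
          (Real.rpow_nonneg (dprimeT_pos hη (e u) (e v)).le _)))
        (x := x) (x' := y) (y := v) hP hdist
  -- the rearranged sum
  rw [laplacian_comm_sum_eq f AD nbp nbm hAD (fun u => Gw u v) x]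
  -- per-direction bound
  have e6 : 1 ≤ Real.exp (c * 6) := Real.one_le_exp (by positivity)
  set B : ℝ := Real.exp (c * 6) * (4 * G₂ * C₀ * ((((ℓb * M₀ : ℕ)) : ℝ) ^ 2)⁻¹
    + 5 * Gg * C₀' * ((((ℓb * M₀ : ℕ)) : ℝ)⁻¹ * η)) * Φ x with hB
  have hμ : ∀ μ : Fin 3, ‖(f x - f (nbp μ x)) • Gw (nbp μ x) v + (f x - f (nbm μ x)) • Gw (nbm μ x) v‖ ≤ B := by
    intro μ
    -- the symmetric / antisymmetric split
    have hsplit : (f x - f (nbp μ x)) • Gw (nbp μ x) v + (f x - f (nbm μ x)) • Gw (nbm μ x) v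
        = ((f x - f (nbp μ x) + (f x - f (nbm μ x))) / 2) • (Gw (nbp μ x) v + Gw (nbm μ x) v)
          + ((f x - f (nbp μ x) - (f x - f (nbm μ x))) / 2) • (Gw (nbp μ x) v - Gw (nbm μ x) v) := by
      module
    -- «(−Δh)(x)»: the second difference
    have hsec : |f x - f (nbp μ x) + (f x - f (nbm μ x))| ≤ (G₂ : ℝ) * ((((ℓb * M₀ : ℕ)) : ℝ)⁻¹) ^ 2 := by
      have h := abs_second_diff_g_torus_le (ℓ := ℓb * M₀) (Nc := Nc) (t := t) hG₂ hwin cz w (e x) (hδbox μ)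
      rw [← hnbp μ x, ← hnbm μ x] at h
      have e1 : f x - f (nbp μ x) + (f x - f (nbm μ x)) = -(f (nbp μ x) + f (nbm μ x) - 2 * f x) := by ring
      rw [e1, abs_neg]
      exact h
    -- «∂h»: the first difference across two steps
    have hfirst : |f x - f (nbp μ x) - (f x - f (nbm μ x))| ≤ Gg * ((((ℓb * M₀ : ℕ)) : ℝ)⁻¹ * ((2 : ℕ) : ℝ)) := by
      have h := abs_sub_g_torus_le (ℓ := ℓb * M₀) (Nc := Nc) (t := t) hGg (s := 2)
        (by have hw := hwin; push_cast at hw ⊢; linarith) cz w (hpm2 μ x)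
      have e1 : f x - f (nbp μ x) - (f x - f (nbm μ x)) = f (nbm μ x) - f (nbp μ x) := by ring
      rw [e1]
      exact h
    -- the values `S_±`
    have hSp := (hop (nbp μ x) (hnbp1 μ x)).1
    have hSm := (hop (nbm μ x) (hnbm1 μ x)).1
    -- the difference `S₊ − S₋` through the gradient bound at `x` and at `x − e_μ`
    have hgrad : ‖Gw (nbp μ x) v - Gw (nbm μ x) v‖ ≤ 5 * Real.exp (c * 6) * C₀' * η * Φ x := by
      have h1 : ‖Gw (nbp μ x) v - Gw x v‖ ≤ C₀' * (η * Φ x) := h198b x μ v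
      have h2 : ‖Gw x v - Gw (nbm μ x) v‖ ≤ C₀' * (η * (4 * Real.exp (c * 6) * Φ x)) := by
        have h := h198b (nbm μ x) μ v
        rw [hinv] at h
        refine h.trans (mul_le_mul_of_nonneg_left (mul_le_mul_of_nonneg_left ?_ hη.le) hC₀')
        exact (hop (nbm μ x) (hnbm1 μ x)).2
      have h3 : ‖Gw (nbp μ x) v - Gw (nbm μ x) v‖ ≤ ‖Gw (nbp μ x) v - Gw x v‖ + ‖Gw x v - Gw (nbm μ x) v‖ := by
        have := norm_add_le (Gw (nbp μ x) v - Gw x v) (Gw x v - Gw (nbm μ x) v)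
        rwa [sub_add_sub_cancel] at this
      have hΦx := hΦ0 x
      have hextra : 0 ≤ (Real.exp (c * 6) - 1) * (C₀' * (η * Φ x)) :=
        mul_nonneg (sub_nonneg.2 e6) (mul_nonneg hC₀' (mul_nonneg hη.le hΦx))
      have hexp : (Real.exp (c * 6) - 1) * (C₀' * (η * Φ x))
          = Real.exp (c * 6) * C₀' * η * Φ x - C₀' * (η * Φ x) := by ring
      rw [hexp] at hextra
      have h2' : C₀' * (η * (4 * Real.exp (c * 6) * Φ x)) = 4 * (Real.exp (c * 6) * C₀' * η * Φ x) := by ring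
      rw [h2'] at h2
      linarith
    rw [hsplit]
    refine (norm_add_le _ _).trans ?_
    rw [norm_smul, norm_smul, Real.norm_eq_abs, Real.norm_eq_abs, abs_div, abs_div, abs_two]
    have n1 := norm_add_le (Gw (nbp μ x) v) (Gw (nbm μ x) v)
    have hΦ₁x := hΦ₁0 x
    have hΦx := hΦ0 x
    have hΦ₁Φx := hΦ₁Φ x
    -- assemble
    have t1 : |f x - f (nbp μ x) + (f x - f (nbm μ x))| / 2 * ‖Gw (nbp μ x) v + Gw (nbm μ x) v‖
        ≤ (G₂ : ℝ) * ((((ℓb * M₀ : ℕ)) : ℝ)⁻¹) ^ 2 / 2 * (2 * (C₀ * (4 * Real.exp (c * 6) * Φ₁ x))) := by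
      refine mul_le_mul (by linarith) (n1.trans (by linarith)) (norm_nonneg _) (by positivity)
    have t2 : |f x - f (nbp μ x) - (f x - f (nbm μ x))| / 2 * ‖Gw (nbp μ x) v - Gw (nbm μ x) v‖
        ≤ Gg * ((((ℓb * M₀ : ℕ)) : ℝ)⁻¹ * ((2 : ℕ) : ℝ)) / 2 * (5 * Real.exp (c * 6) * C₀' * η * Φ x) := by
      refine mul_le_mul (by linarith) hgrad (norm_nonneg _) (by positivity)
    refine (add_le_add t1 t2).trans ?_
    have hi : 0 ≤ ((((ℓb * M₀ : ℕ)) : ℝ))⁻¹ := inv_nonneg.2 hℓpos.le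
    have hcoef : 0 ≤ 4 * Real.exp (c * 6) * G₂ * C₀ * ((((ℓb * M₀ : ℕ)) : ℝ))⁻¹ ^ 2 := by positivity
    have hmono := mul_le_mul_of_nonneg_left hΦ₁Φx hcoef
    calc (G₂ : ℝ) * ((((ℓb * M₀ : ℕ)) : ℝ)⁻¹) ^ 2 / 2 * (2 * (C₀ * (4 * Real.exp (c * 6) * Φ₁ x)))
          + Gg * ((((ℓb * M₀ : ℕ)) : ℝ)⁻¹ * ((2 : ℕ) : ℝ)) / 2 * (5 * Real.exp (c * 6) * C₀' * η * Φ x)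
        = 4 * Real.exp (c * 6) * G₂ * C₀ * ((((ℓb * M₀ : ℕ)) : ℝ))⁻¹ ^ 2 * Φ₁ x
          + 5 * Real.exp (c * 6) * Gg * C₀' * (((((ℓb * M₀ : ℕ)) : ℝ))⁻¹ * η) * Φ x := by
          push_cast
          ring
      _ ≤ 4 * Real.exp (c * 6) * G₂ * C₀ * ((((ℓb * M₀ : ℕ)) : ℝ))⁻¹ ^ 2 * Φ x
          + 5 * Real.exp (c * 6) * Gg * C₀' * (((((ℓb * M₀ : ℕ)) : ℝ))⁻¹ * η) * Φ x := by
          linarith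
      _ = B := by
          simp only [hB]
          ring
  -- sum over the three directions and the prefactor `η⁻²`
  have hsum : ‖∑ μ : Fin 3, ((f x - f (nbp μ x)) • Gw (nbp μ x) v + (f x - f (nbm μ x)) • Gw (nbm μ x) v)‖
      ≤ 3 * B := by
    refine (norm_sum_le _ _).trans ?_
    calc ∑ μ : Fin 3, ‖(f x - f (nbp μ x)) • Gw (nbp μ x) v + (f x - f (nbm μ x)) • Gw (nbm μ x) v‖
        ≤ ∑ _μ : Fin 3, B := sum_le_sum fun μ _ => hμ μ
      _ = 3 * B := by rw [sum_const, card_univ, Fintype.card_fin, nsmul_eq_mul, Nat.cast_ofNat]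
  rw [norm_smul, Real.norm_eq_abs, abs_neg, abs_of_nonneg (show (0 : ℝ) ≤ η⁻¹ ^ 2 by positivity)]
  refine (mul_le_mul_of_nonneg_left hsum (by positivity)).trans ?_
  -- the arithmetic: `η⁻²·3B ≤ C_Δ∕M₀ · Φ x` using `ℓ = ℓ_bM₀` and `M₀ ≥ 1`
  simp only [hB]
  rw [hℓ]
  have hηℓ : 0 < η * ℓb := mul_pos hη hℓbr
  have hM₀' : (0 : ℝ) < M₀ := by linarith
  have hΦx := hΦ0 x
  have hM2 : ((M₀ : ℝ) ^ 2)⁻¹ ≤ ((M₀ : ℝ))⁻¹ := by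
    apply inv_anti₀ hM₀'
    nlinarith
  -- write both sides explicitly
  have lhs_eq : η⁻¹ ^ 2 * (3 * (Real.exp (c * 6) * (4 * (G₂ : ℝ) * C₀ * (((ℓb : ℝ) * (M₀ : ℝ)) ^ 2)⁻¹
      + 5 * Gg * C₀' * (((ℓb : ℝ) * (M₀ : ℝ))⁻¹ * η)) * Φ x))
      = 3 * Real.exp (c * 6) * (4 * (G₂ : ℝ) * C₀ * ((η * (ℓb : ℝ)) ^ 2)⁻¹) * Φ x * ((M₀ : ℝ) ^ 2)⁻¹
        + 3 * Real.exp (c * 6) * (5 * Gg * C₀' * (η * (ℓb : ℝ))⁻¹) * Φ x * ((M₀ : ℝ))⁻¹ := by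
    field_simp
  have rhs_eq : 3 * Real.exp (c * 6) * (4 * (G₂ : ℝ) * C₀ * ((η * (ℓb : ℝ)) ^ 2)⁻¹
      + 5 * Gg * C₀' * (η * (ℓb : ℝ))⁻¹) / (M₀ : ℝ) * Φ x
      = 3 * Real.exp (c * 6) * (4 * (G₂ : ℝ) * C₀ * ((η * (ℓb : ℝ)) ^ 2)⁻¹) * Φ x * ((M₀ : ℝ))⁻¹
        + 3 * Real.exp (c * 6) * (5 * Gg * C₀' * (η * (ℓb : ℝ))⁻¹) * Φ x * ((M₀ : ℝ))⁻¹ := by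
    rw [div_eq_mul_inv]
    ring
  show η⁻¹ ^ 2 * (3 * (Real.exp (c * 6) * (4 * (G₂ : ℝ) * C₀ * (((ℓb : ℝ) * (M₀ : ℝ)) ^ 2)⁻¹
      + 5 * Gg * C₀' * (((ℓb : ℝ) * (M₀ : ℝ))⁻¹ * η)) * Φ x))
    ≤ 3 * Real.exp (c * 6) * (4 * (G₂ : ℝ) * C₀ * ((η * (ℓb : ℝ)) ^ 2)⁻¹
      + 5 * Gg * C₀' * (η * (ℓb : ℝ))⁻¹) / (M₀ : ℝ) * Φ x
  rw [lhs_eq, rhs_eq]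
  have hK1 : 0 ≤ 3 * Real.exp (c * 6) * (4 * (G₂ : ℝ) * C₀ * ((η * (ℓb : ℝ)) ^ 2)⁻¹) * Φ x := by positivity
  have hmono := mul_le_mul_of_nonneg_left hM2 hK1
  linarith

omit [DecidableEq X] [NormedAlgebra ℝ E] [NormOneClass E] [NeZero Nb] [NeZero Nc] in
/-- **«The same bound holds easily for `|(R^Q_□G*_□)(x,y)|`»** — the averaging part of (200) on the torus at the boson
profile: with `A_Q(x,u) ≠ 0 ⟹ Δ_u = Δ_x`, `‖A_Q(x,u)‖ ≤ a_Q` and the value bound (198),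
`Σ_u|h_w(x) − h_w(u)|‖A_Q(x,u)‖‖G_w(u,v)‖ ≤ (Gℓ_b∕ℓ)·a_Q·C₀·κ₁·d′_T(e x,e v)^{−1}e^{−c·d(Δ_x,Δ_v)}`, `κ₁ = 2(ηR)³ + 2C(1)(ηR)²(ηℓ_b)`
— (150) on the torus and §3 (the fermion `sum_avg_part_le` at `α = 1`).
[cite: Dimock2004QED3TorusII, §3.3 (201) p.30 L44–45 and §3.2 (149)–(151) p.24 L29–58] -/
theorem sum_avg_part_one_le {c η t Gg aQ C₀ : ℝ} (hmodS : Ns = ℓb * Nb) (e : X → TPt 3 Ns)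
    (he : Function.Injective e) (β : X → TPt 3 Nb) (hβ : ∀ x, β x = czmap ℓb Nb (e x)) (hη : 0 < η)
    {R : ℕ} (hR : 1 ≤ R) (hblk : ∀ b, (univ.filter fun u => β u = b).card ≤ R ^ 3)
    (hGg : ∀ z : Fin 3 → ℝ, ‖fderiv ℝ (g : (Fin 3 → ℝ) → ℝ) z‖ ≤ Gg)
    (hwin : (((ℓb * M₀ : ℕ)) : ℝ) * (|t| + 3 / 5) + ((ℓb - 1 : ℕ) : ℝ) < (Ns : ℝ) / 2)
    (cz : TPt 3 Nc → TPt 3 Ns) (w : TPt 3 Nc)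
    (AQ : Matrix X X E) (hAQ : ∀ x u, AQ x u ≠ 0 → β u = β x) (haQ : 0 ≤ aQ)
    (hAQn : ∀ x u, ‖AQ x u‖ ≤ aQ) (Gw : Matrix X X E) (hC₀ : 0 ≤ C₀)
    (h198a : ∀ u v, ‖Gw u v‖ ≤ C₀ * ((η ^ 3 * (η * dOne (vmaVec (e u - e v))) ^ (-(1 : ℝ)))
      * Real.exp (-(c * torusDist (β u) (β v)))))
    (x v : X) :
    ∑ u, |g (fun i => (((ℓb * M₀ : ℕ) : ℝ))⁻¹ * (((e x - cz w) i).valMinAbs : ℝ) - t)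
          - g (fun i => (((ℓb * M₀ : ℕ) : ℝ))⁻¹ * (((e u - cz w) i).valMinAbs : ℝ) - t)| * ‖AQ x u‖ * ‖Gw u v‖
      ≤ (Gg * ((((ℓb * M₀ : ℕ)) : ℝ)⁻¹ * (ℓb : ℝ))) * aQ * C₀
          * (2 * (η * R) ^ 3 + 2 * blockConst 1 * (η * R) ^ 2 * (η * ℓb))
          * ((η * dOne (vmaVec (e x - e v))) ^ (-(1 : ℝ)) * Real.exp (-(c * torusDist (β x) (β v)))) := by
  haveI : NeZero (ℓb * M₀) := ⟨Nat.mul_ne_zero (NeZero.ne ℓb) (NeZero.ne M₀)⟩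
  have hGg0 : 0 ≤ Gg := (norm_nonneg _).trans (hGg 0)
  have hC1 : 0 ≤ blockConst 1 := zero_le_one.trans (one_le_blockConst (α := 1) (by norm_num))
  have hd1 : 0 < dOne (vmaVec (e x - e v)) := dOne_pos _
  set F : Finset X := univ.filter fun u => β u = β x
  set K : ℝ := (Gg * ((((ℓb * M₀ : ℕ)) : ℝ)⁻¹ * ((ℓb - 1 : ℕ) : ℝ))) * aQ
    * (C₀ * Real.exp (-(c * torusDist (β x) (β v)))) with hK
  have hK0 : 0 ≤ K := by
    simp only [hK]
    positivity
  have hterm : ∀ u ∈ F,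
      |g (fun i => (((ℓb * M₀ : ℕ) : ℝ))⁻¹ * (((e x - cz w) i).valMinAbs : ℝ) - t)
          - g (fun i => (((ℓb * M₀ : ℕ) : ℝ))⁻¹ * (((e u - cz w) i).valMinAbs : ℝ) - t)| * ‖AQ x u‖ * ‖Gw u v‖
        ≤ K * (η ^ 3 * (η * dOne (vmaVec (e u - e v))) ^ (-(1 : ℝ))) := by
    intro u hu
    have hux : β u = β x := (mem_filter.1 hu).2
    have hmem : e u ∈ tball (e x) (ℓb - 1) := by
      refine mem_tball_of_czmap_eq (Ls := ℓb) (Nc := Nb) hmodS ?_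
      rw [← hβ, ← hβ]
      exact hux
    have hlip := abs_sub_g_torus_le (ℓ := ℓb * M₀) (Nc := Nc) (t := t) hGg hwin cz w hmem
    have hG := h198a u v
    rw [hux] at hG
    have hP0 : 0 ≤ η ^ 3 * (η * dOne (vmaVec (e u - e v))) ^ (-(1 : ℝ)) :=
      mul_nonneg (pow_nonneg hη.le 3) (Real.rpow_nonneg (dprimeT_pos hη (e u) (e v)).le _)
    calc |g (fun i => (((ℓb * M₀ : ℕ) : ℝ))⁻¹ * (((e x - cz w) i).valMinAbs : ℝ) - t)
            - g (fun i => (((ℓb * M₀ : ℕ) : ℝ))⁻¹ * (((e u - cz w) i).valMinAbs : ℝ) - t)| * ‖AQ x u‖ * ‖Gw u v‖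
        ≤ (Gg * ((((ℓb * M₀ : ℕ)) : ℝ)⁻¹ * ((ℓb - 1 : ℕ) : ℝ))) * aQ
            * (C₀ * ((η ^ 3 * (η * dOne (vmaVec (e u - e v))) ^ (-(1 : ℝ)))
              * Real.exp (-(c * torusDist (β x) (β v))))) :=
          mul_le_mul (mul_le_mul hlip (hAQn x u) (norm_nonneg _) (by positivity)) hG (norm_nonneg _)
            (by positivity)
      _ = K * (η ^ 3 * (η * dOne (vmaVec (e u - e v))) ^ (-(1 : ℝ))) := by
          simp only [hK]
          ring
  have hvan : ∀ u ∈ (univ : Finset X),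
      |g (fun i => (((ℓb * M₀ : ℕ) : ℝ))⁻¹ * (((e x - cz w) i).valMinAbs : ℝ) - t)
          - g (fun i => (((ℓb * M₀ : ℕ) : ℝ))⁻¹ * (((e u - cz w) i).valMinAbs : ℝ) - t)| * ‖AQ x u‖ * ‖Gw u v‖ ≠ 0 →
        β u = β x := by
    intro u _ hne
    by_contra hu
    apply hne
    have h0 : AQ x u = 0 := by
      by_contra h
      exact hu (hAQ x u h)
    rw [h0, norm_zero, mul_zero, zero_mul]
  rw [← sum_filter_of_ne hvan]
  have hdx := dprimeT_pos hη (e x) (e v)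
  have hle : ((ℓb - 1 : ℕ) : ℝ) ≤ (ℓb : ℝ) := by exact_mod_cast Nat.sub_le ℓb 1
  have hM : 0 ≤ Gg * (((ℓb * M₀ : ℕ) : ℝ))⁻¹ * aQ * C₀
      * (2 * (η * R) ^ 3 + 2 * blockConst 1 * (η * R) ^ 2 * (η * ℓb))
      * ((η * dOne (vmaVec (e x - e v))) ^ (-(1 : ℝ)) * Real.exp (-(c * torusDist (β x) (β v)))) := by
    positivity
  calc ∑ u ∈ F, |g (fun i => (((ℓb * M₀ : ℕ) : ℝ))⁻¹ * (((e x - cz w) i).valMinAbs : ℝ) - t)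
          - g (fun i => (((ℓb * M₀ : ℕ) : ℝ))⁻¹ * (((e u - cz w) i).valMinAbs : ℝ) - t)| * ‖AQ x u‖ * ‖Gw u v‖
      ≤ ∑ u ∈ F, K * (η ^ 3 * (η * dOne (vmaVec (e u - e v))) ^ (-(1 : ℝ))) := sum_le_sum hterm
    _ = K * ∑ u ∈ F, η ^ 3 * (η * dOne (vmaVec (e u - e v))) ^ (-(1 : ℝ)) := by rw [mul_sum]
    _ ≤ K * ((2 * (η * R) ^ 3 + 2 * blockConst 1 * (η * R) ^ 2 * (η * ℓb))
          * (η * dOne (vmaVec (e x - e v))) ^ (-(1 : ℝ))) :=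
        mul_le_mul_of_nonneg_left (sum_block_dprimeT_one_le hmodS e he β hβ hη hR hblk x v) hK0
    _ = ((ℓb - 1 : ℕ) : ℝ) * (Gg * (((ℓb * M₀ : ℕ) : ℝ))⁻¹ * aQ * C₀
          * (2 * (η * R) ^ 3 + 2 * blockConst 1 * (η * R) ^ 2 * (η * ℓb))
          * ((η * dOne (vmaVec (e x - e v))) ^ (-(1 : ℝ)) * Real.exp (-(c * torusDist (β x) (β v))))) := by
        simp only [hK]
        ring
    _ ≤ (ℓb : ℝ) * (Gg * (((ℓb * M₀ : ℕ) : ℝ))⁻¹ * aQ * C₀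
          * (2 * (η * R) ^ 3 + 2 * blockConst 1 * (η * R) ^ 2 * (η * ℓb))
          * ((η * dOne (vmaVec (e x - e v))) ^ (-(1 : ℝ)) * Real.exp (-(c * torusDist (β x) (β v))))) :=
        mul_le_mul_of_nonneg_right hle hM
    _ = _ := by ring


omit [NeZero Nc] in
/-- **(201) ON THE TORUS for `h_□ :=` the periodized (124)** — the boson later-link bound: for `A` with off-diagonal
entries `A_Δ(x,u) + A_Q(x,u)` (`A_Δ` acting as `−Δ`, `A_Q` the block average of sup `a_Q`; the diagonal free) and local
inverses `G*_□ = G_w` obeying LEMMA 3 (198) (value constant `C₀`, forward-gradient constant `C₀′`, rate `c`):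
`‖(R_□G*_□h_□)(x,v)‖ ≤ C₁∕M₀ · η³(d′_T^{−1} + d′_T^{−2})(e x,e v)e^{−c·d(Δ_x,Δ_v)}`,
`C₁ = 3e^{6c}(4G₂C₀(ηℓ_b)^{−2} + 5GC₀′(ηℓ_b)^{−1}) + Ga_QC₀κ₁∕η³` — the hypothesis `hR'` of `dimock_thm2_torus_dprime`, with
the same decay rate as (198). [cite: Dimock2004QED3TorusII, §3.3 (200)–(201) p.30 L36–45] -/
theorem eq201_torus {c η t Gg aQ C₀ C₀' : ℝ} {G₂ : ℝ≥0} (hmodS : Ns = ℓb * Nb) (e : X → TPt 3 Ns)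
    (he : Function.Injective e) (β : X → TPt 3 Nb) (hβ : ∀ x, β x = czmap ℓb Nb (e x)) (hη : 0 < η) (hc : 0 ≤ c)
    {R : ℕ} (hR : 1 ≤ R) (hblk : ∀ b, (univ.filter fun u => β u = b).card ≤ R ^ 3)
    (hGg : ∀ z : Fin 3 → ℝ, ‖fderiv ℝ (g : (Fin 3 → ℝ) → ℝ) z‖ ≤ Gg)
    (hG₂ : LipschitzWith G₂ (fderiv ℝ (g : (Fin 3 → ℝ) → ℝ)))
    (hwin : (((ℓb * M₀ : ℕ)) : ℝ) * (|t| + 3 / 5) + ℓb + 2 < (Ns : ℝ) / 2)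
    (cz : TPt 3 Nc → TPt 3 Ns) (H : TPt 3 Nc → Matrix X X E)
    (hH : ∀ w, H w = Matrix.diagonal fun x =>
      algebraMap ℝ E (g (fun i => (((ℓb * M₀ : ℕ) : ℝ))⁻¹ * (((e x - cz w) i).valMinAbs : ℝ) - t)))
    (nbp nbm : Fin 3 → X → X) (hnbp : ∀ μ x, e (nbp μ x) = e x + proj Ns (Pi.single μ 1))
    (hnbm : ∀ μ x, e (nbm μ x) = e x + proj Ns (-Pi.single μ 1))
    (A AD AQ : Matrix X X E) (hA : ∀ x u, x ≠ u → A x u = AD x u + AQ x u)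
    (hAD : ∀ (S : X → E) (x : X), ∑ u, AD x u * S u
      = (-(η⁻¹ ^ 2)) • ∑ μ, (S (nbp μ x) + S (nbm μ x) - (2 : ℝ) • S x))
    (hAQ : ∀ x u, AQ x u ≠ 0 → β u = β x) (haQ : 0 ≤ aQ) (hAQn : ∀ x u, ‖AQ x u‖ ≤ aQ)
    (G : TPt 3 Nc → Matrix X X E) (hC₀ : 0 ≤ C₀) (hC₀' : 0 ≤ C₀')
    (h198a : ∀ w u v, ‖G w u v‖ ≤ C₀ * ((η ^ 3 * (η * dOne (vmaVec (e u - e v))) ^ (-(1 : ℝ)))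
      * Real.exp (-(c * torusDist (β u) (β v)))))
    (h198b : ∀ w x μ v, ‖G w (nbp μ x) v - G w x v‖ ≤ C₀' * (η * ((η ^ 3 *
      ((η * dOne (vmaVec (e x - e v))) ^ (-(1 : ℝ)) + (η * dOne (vmaVec (e x - e v))) ^ (-(2 : ℝ))))
        * Real.exp (-(c * torusDist (β x) (β v))))))
    (w : TPt 3 Nc) (x v : X) :
    ‖linkR A H G w x v‖
      ≤ (3 * Real.exp (c * 6) * (4 * G₂ * C₀ * ((η * ℓb) ^ 2)⁻¹ + 5 * Gg * C₀' * (η * ℓb)⁻¹)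
          + Gg * aQ * C₀ * (2 * (η * R) ^ 3 + 2 * blockConst 1 * (η * R) ^ 2 * (η * ℓb)) / η ^ 3) / (M₀ : ℝ)
        * ((η ^ 3 * ((η * dOne (vmaVec (e x - e v))) ^ (-(1 : ℝ)) + (η * dOne (vmaVec (e x - e v))) ^ (-(2 : ℝ))))
          * Real.exp (-(c * torusDist (β x) (β v)))) := by
  have hℓb : 0 < ℓb := Nat.pos_of_ne_zero (NeZero.ne ℓb)
  have hM₀ : 0 < M₀ := Nat.pos_of_ne_zero (NeZero.ne M₀)
  have hℓbr : (0 : ℝ) < ℓb := by exact_mod_cast hℓb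
  have hM₀r : (0 : ℝ) < M₀ := by exact_mod_cast hM₀
  have hℓb0 : (ℓb : ℝ) ≠ 0 := hℓbr.ne'
  have hM₀0 : (M₀ : ℝ) ≠ 0 := hM₀r.ne'
  have hη0 : η ≠ 0 := hη.ne'
  have hGg0 : 0 ≤ Gg := (norm_nonneg _).trans (hGg 0)
  have hC1 : 0 ≤ blockConst 1 := zero_le_one.trans (one_le_blockConst (α := 1) (by norm_num))
  have hℓ : (((ℓb * M₀ : ℕ)) : ℝ) = (ℓb : ℝ) * M₀ := by push_cast; ring
  have hwin2 : (((ℓb * M₀ : ℕ)) : ℝ) * (|t| + 3 / 5) + 2 < (Ns : ℝ) / 2 := by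
    have : (0 : ℝ) ≤ ℓb := hℓbr.le
    linarith
  have hwinb : (((ℓb * M₀ : ℕ)) : ℝ) * (|t| + 3 / 5) + ((ℓb - 1 : ℕ) : ℝ) < (Ns : ℝ) / 2 := by
    have : ((ℓb - 1 : ℕ) : ℝ) ≤ ℓb := by exact_mod_cast Nat.sub_le ℓb 1
    linarith
  have hf1 : ∀ (w : TPt 3 Nc) (x : X),
      |g (fun i => (((ℓb * M₀ : ℕ) : ℝ))⁻¹ * (((e x - cz w) i).valMinAbs : ℝ) - t)| ≤ 1 :=
    fun w x => abs_le.2 ⟨by linarith [g_nonneg (fun i => (((ℓb * M₀ : ℕ) : ℝ))⁻¹ *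
      (((e x - cz w) i).valMinAbs : ℝ) - t)], g_le_one _⟩
  have h1 := norm_linkR_le_split
    (fun w x => g (fun i => (((ℓb * M₀ : ℕ) : ℝ))⁻¹ * (((e x - cz w) i).valMinAbs : ℝ) - t)) hH hf1 A AD AQ hA G w x v
  have hD := sum_laplacian_part_le (M₀ := M₀) hmodS e he β hβ hη hc hGg hG₂ hwin2 cz w nbp nbm hnbp hnbm AD hAD
    (G w) hC₀ hC₀' (h198a w) (h198b w) x v
  have hQ := sum_avg_part_one_le (M₀ := M₀) hmodS e he β hβ hη hR hblk hGg hwinb cz w AQ hAQ haQ hAQn (G w) hC₀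
    (h198a w) x v
  -- the averaging part in the boson currency
  have hd := dprimeT_pos hη (e x) (e v)
  have hD1 : 0 ≤ (η * dOne (vmaVec (e x - e v))) ^ (-(1 : ℝ)) := Real.rpow_nonneg hd.le _
  have hD2 : 0 ≤ (η * dOne (vmaVec (e x - e v))) ^ (-(2 : ℝ)) := Real.rpow_nonneg hd.le _
  have hex : 0 ≤ Real.exp (-(c * torusDist (β x) (β v))) := (Real.exp_pos _).le
  have hη3 : 0 ≤ η ^ 3 := pow_nonneg hη.le 3
  have hΦ₁Φ : (η ^ 3 * (η * dOne (vmaVec (e x - e v))) ^ (-(1 : ℝ))) * Real.exp (-(c * torusDist (β x) (β v)))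
      ≤ (η ^ 3 * ((η * dOne (vmaVec (e x - e v))) ^ (-(1 : ℝ)) + (η * dOne (vmaVec (e x - e v))) ^ (-(2 : ℝ))))
        * Real.exp (-(c * torusDist (β x) (β v))) := by
    have hsplit : (η ^ 3 * ((η * dOne (vmaVec (e x - e v))) ^ (-(1 : ℝ))
        + (η * dOne (vmaVec (e x - e v))) ^ (-(2 : ℝ)))) * Real.exp (-(c * torusDist (β x) (β v)))
        = (η ^ 3 * (η * dOne (vmaVec (e x - e v))) ^ (-(1 : ℝ))) * Real.exp (-(c * torusDist (β x) (β v)))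
          + (η ^ 3 * (η * dOne (vmaVec (e x - e v))) ^ (-(2 : ℝ))) * Real.exp (-(c * torusDist (β x) (β v))) := by
      ring
    rw [hsplit]
    linarith [mul_nonneg (mul_nonneg hη3 hD2) hex]
  have hQ' : (Gg * ((((ℓb * M₀ : ℕ)) : ℝ)⁻¹ * (ℓb : ℝ))) * aQ * C₀
      * (2 * (η * R) ^ 3 + 2 * blockConst 1 * (η * R) ^ 2 * (η * ℓb))
      * ((η * dOne (vmaVec (e x - e v))) ^ (-(1 : ℝ)) * Real.exp (-(c * torusDist (β x) (β v))))
      ≤ (Gg * aQ * C₀ * (2 * (η * R) ^ 3 + 2 * blockConst 1 * (η * R) ^ 2 * (η * ℓb)) / η ^ 3) / (M₀ : ℝ)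
        * ((η ^ 3 * ((η * dOne (vmaVec (e x - e v))) ^ (-(1 : ℝ)) + (η * dOne (vmaVec (e x - e v))) ^ (-(2 : ℝ))))
          * Real.exp (-(c * torusDist (β x) (β v)))) := by
    have heq : (Gg * ((((ℓb * M₀ : ℕ)) : ℝ)⁻¹ * (ℓb : ℝ))) * aQ * C₀
        * (2 * (η * R) ^ 3 + 2 * blockConst 1 * (η * R) ^ 2 * (η * ℓb))
        * ((η * dOne (vmaVec (e x - e v))) ^ (-(1 : ℝ)) * Real.exp (-(c * torusDist (β x) (β v))))
        = (Gg * aQ * C₀ * (2 * (η * R) ^ 3 + 2 * blockConst 1 * (η * R) ^ 2 * (η * ℓb)) / η ^ 3) / (M₀ : ℝ)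
          * ((η ^ 3 * (η * dOne (vmaVec (e x - e v))) ^ (-(1 : ℝ))) * Real.exp (-(c * torusDist (β x) (β v)))) := by
      rw [hℓ]
      field_simp
    rw [heq]
    exact mul_le_mul_of_nonneg_left hΦ₁Φ (by positivity)
  refine h1.trans ((add_le_add hD hQ).trans ((add_le_add le_rfl hQ').trans (le_of_eq ?_)))
  ring

end PartII

/-! ## §5 THEOREM 2, single scale, on the 3-torus, with `h_□ :=` the periodized (124), FROM LEMMA 3 ALONE -/

section Theorem2

variable {Nb Nc M₀ : ℕ} [NeZero Nb] [NeZero Nc] [NeZero M₀]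
variable {X : Type*} [Fintype X] [DecidableEq X] {E : Type*} [NormedRing E] [NormedAlgebra ℝ E] [NormOneClass E]

omit [NormOneClass E] in
/-- **THEOREM 2 (194)–(195), single scale, on the 3-torus, with `h_□ :=` THE PRINTED (124) periodized and the boson
profiles: (125), (202)∕(203), the supports and the adjacency ALL DERIVED** — the boson twin of `dimock_thm1_torus_printed`
(same data; first-link profile `η³d′_T^{−1}` ((198)), later-link profile `η³(d′_T^{−1} + d′_T^{−2})` ((201))).  Hypotheses left:
(197) as `h_□AG*_□ = h_□`, the link bounds (198) ∕ (201) in printed shape, the explicit largeness ∕ range arithmetic.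
[cite: Dimock2004QED3TorusII, §3.3 Thm 2 (194)–(195) p.29 L55 – p.30 L5, Lemma 3 (197)–(198) p.30 L14–22, proof (199)–(203) p.30 L24 – p.31 L6; §3.1 (124)–(126) p.20 L82 – p.21 L15] -/
theorem dimock_thm2_torus_printed [CompleteSpace E] {c η t : ℝ} {Ns ℓb R r ρs : ℕ} {τ : ℤ} [NeZero Ns] [NeZero ℓb]
    (hmod : Nb = M₀ * Nc) (hmodS : Ns = ℓb * Nb) (hNc : 2 * |t| + 6 / 5 < (Nc : ℝ))
    (e : X → TPt 3 Ns) (he : Function.Injective e)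
    (β : X → TPt 3 Nb) (hβ : ∀ x, β x = czmap ℓb Nb (e x)) (ctr : TPt 3 Nb → X) (hctr : ∀ b, β (ctr b) = b)
    (hblk : ∀ b, (univ.filter fun u => β u = b).card ≤ R ^ 3) (hR : 1 ≤ R) (hη : 0 < η) (hc : 0 < c)
    {cz : TPt 3 Nc → TPt 3 Ns} (hcz : ∀ w, cz w = proj Ns fun i => ((ℓb * M₀ : ℕ) : ℤ) * natLift w i)
    (hτ0 : 0 ≤ τ) (hτℓ : τ < (ℓb * M₀ : ℕ)) (hτ : |((ℓb * M₀ : ℕ) : ℝ) * t - τ| ≤ 1 / 2)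
    (hr : (3 / 5 : ℝ) * ((ℓb * M₀ : ℕ) : ℝ) + 1 / 2 ≤ r)
    (H : TPt 3 Nc → Matrix X X E)
    (hH : ∀ w, H w = Matrix.diagonal fun x =>
      algebraMap ℝ E (g (fun i => (((ℓb * M₀ : ℕ) : ℝ))⁻¹ * (((e x - cz w) i).valMinAbs : ℝ) - t)))
    (A : Matrix X X E) (hA : ∀ x y, A x y ≠ 0 → e y ∈ tball (e x) ρs)
    (hRρ : 2 * (r / ℓb + 1) + (ρs / ℓb + 1) < 2 * M₀) (hRρ' : (r / ℓb + 1) + (ρs / ℓb + 1) < M₀)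
    (G : TPt 3 Nc → Matrix X X E) (h136 : ∀ w, H w * A * G w = H w)
    {C₀ C₁ : ℝ} (hC₀ : 0 ≤ C₀) (hC₁ : 0 ≤ C₁)
    (h0 : ∀ w u v, ‖link0 H G w u v‖ ≤ C₀ * ((η ^ 3 * (η * dOne (vmaVec (e u - e v))) ^ (-(1 : ℝ)))
      * Real.exp (-(c * torusDist (β u) (β v)))))
    (hR' : ∀ w u v, ‖linkR A H G w u v‖ ≤ C₁ / (M₀ : ℝ) *
      ((η ^ 3 * ((η * dOne (vmaVec (e u - e v))) ^ (-(1 : ℝ)) + (η * dOne (vmaVec (e u - e v))) ^ (-(2 : ℝ))))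
        * Real.exp (-(c * torusDist (β u) (β v)))))
    (hlarge : 2 * (((3 ^ 3 : ℕ) : ℝ) *
        (C₁ * (2 ^ ((1 : ℝ) + 1) * blockConst 1 * (η * R) ^ ((3 : ℝ) - 1)
          + 2 * (Real.sqrt 8 * blockConst 2 * (η * R))
          + 2 ^ ((2 : ℝ) + 1) * blockConst 2 * (η * R) ^ ((3 : ℝ) - 2)) * K₁ 3 (c / 2))) ≤ (M₀ : ℝ)) :
    (∀ x y, Summable fun n => (Gstar H G * Kop A H G ^ n) x y) ∧
    A * walkExpansion A H G = 1 ∧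
    ∀ x y, ‖walkExpansion A H G x y‖
      ≤ 2 * ((3 ^ 3 : ℕ) : ℝ) * C₀ * ((η ^ 3 * (η * dOne (vmaVec (e x - e y))) ^ (-(1 : ℝ)))
          * Real.exp (-(c / 2) * torusDist (β x) (β y))) := by
  have hℓ : NeZero (ℓb * M₀) := ⟨Nat.mul_ne_zero (NeZero.ne ℓb) (NeZero.ne M₀)⟩
  have hℓb : 0 < ℓb := Nat.pos_of_ne_zero (NeZero.ne ℓb)
  have hℓbz : (0 : ℤ) < ℓb := by exact_mod_cast hℓb
  have hmodS' : Ns = (ℓb * M₀) * Nc := by rw [hmodS, hmod, Nat.mul_assoc]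
  -- the anchors: the blocks of the centre sites `cz w + τ`
  set anc : TPt 3 Nc → TPt 3 Nb := fun w => czmap ℓb Nb (cz w + proj Ns fun _ => τ) with hanc_def
  have hanc : ∀ w, anc w = proj Nb fun i => (M₀ : ℤ) * natLift w i + (fun _ : Fin 3 => τ / ℓb) i :=
    fun w => czmap_centre_site (Nb := Nb) (M₀ := M₀) hmodS τ hcz w
  have hc₀ : ∀ i : Fin 3, 0 ≤ (fun _ : Fin 3 => τ / (ℓb : ℤ)) i ∧ (fun _ : Fin 3 => τ / (ℓb : ℤ)) i < M₀ := by
    intro i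
    refine ⟨Int.ediv_nonneg hτ0 hℓbz.le, ?_⟩
    show τ / (ℓb : ℤ) < M₀
    rw [Int.ediv_lt_iff_lt_mul hℓbz]
    have : ((ℓb * M₀ : ℕ) : ℤ) = (M₀ : ℤ) * ℓb := by push_cast; ring
    rw [← this]
    exact_mod_cast hτℓ
  -- the support of `h_w` at block level: `β x ∈ (anc w)^{∼(r∕ℓ_b + 1)}`
  have hφ : ∀ w x, algebraMap ℝ E (g (fun i => (((ℓb * M₀ : ℕ) : ℝ))⁻¹ * (((e x - cz w) i).valMinAbs : ℝ) - t)) ≠ 0 →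
      β x ∈ tball (anc w) (r / ℓb + 1) := by
    intro w x hx
    have hx' : g (fun i => (((ℓb * M₀ : ℕ) : ℝ))⁻¹ * (((e x - cz w) i).valMinAbs : ℝ) - t) ≠ 0 :=
      fun h0 => hx (by rw [h0, map_zero])
    have h1 : e x ∈ tball (cz w + proj Ns fun _ => τ) r :=
      mem_tball_of_g_torus_ne_zero (ℓ := ℓb * M₀) hτ hr cz w (e x) hx'
    have h2 := czmap_mem_tball (Ls := ℓb) (Nc := Nb) hmodS h1
    rw [← hβ x] at h2
    exact h2
  -- the range of `A` at block level
  have hA' : ∀ x y, A x y ≠ 0 → β y ∈ tball (β x) (ρs / ℓb + 1) := by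
    intro x y hxy
    have h2 := czmap_mem_tball (Ls := ℓb) (Nc := Nb) hmodS (hA x y hxy)
    rw [← hβ x, ← hβ y] at h2
    exact h2
  exact dimock_thm2_torus_dprime hmod e he β ctr hctr hblk hR hη (fun w => w) (fun _ _ h => h)
    (fun _ => τ / (ℓb : ℤ)) hc₀ anc hanc hc
    (fun w x => algebraMap ℝ E (g (fun i => (((ℓb * M₀ : ℕ) : ℝ))⁻¹ * (((e x - cz w) i).valMinAbs : ℝ) - t)))
    H hH hφ A hA' hRρ hRρ' G (h125_torus hmodS' t hNc hcz e H hH) h136 hC₀ hC₁ h0 hR' hlarge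


/-- **THEOREM 2 (195), single scale, on the 3-torus, with `h_□ :=` the printed (124) periodized, FROM LEMMA 3 ALONE.**
Data as in `dimock_thm2_torus_printed` plus the lattice structure of `X` (neighbour maps `x ↦ x ± e_μ` with
`e(x ± e_μ) = e x ± e_μ`); the operator `A` with off-diagonal entries `A_Δ + A_Q` — `A_Δ` acting as the lattice `−Δ` at
spacing `η` (its entries supported on nearest neighbours), `A_Q(x,u) ≠ 0 ⟹ Δ_u = Δ_x`, `‖A_Q‖ ≤ a_Q` ((197)); HYPOTHESES =
LEMMA 3: (197) as `h_□AG*_□ = h_□` and (198) `‖G*_□(u,v)‖ ≤ C₀η³d′_T(e u,e v)^{−1}e^{−c·d(Δ_u,Δ_v)}`,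
`‖G*_□(x + e_μ,v) − G*_□(x,v)‖ ≤ C₀′η·η³(d′_T^{−1} + d′_T^{−2})(e x,e v)e^{−c·d(Δ_x,Δ_v)}`; plus the window ∕ size conditions and
*"Let `M_0` be sufficiently large"*: `2·3³·C₁θ′K₁(3,c∕2) ≤ M₀` with the EXPLICIT `C₁` of `eq201_torus` and
`θ′ = 4C(1)(ηR)² + 2√8C(2)(ηR) + 8C(2)(ηR)` ((202)–(203)).  DERIVED: (125), the supports, the range of `A`, (201)
(`eq201_torus`), (202)–(203), the adjacency and path counts.  THEN the walk expansion (199) converges entrywise,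
`A·G_k = 1`, and (195) `‖G_k(x,y)‖ ≤ 2·3³·C₀·η³d′_T(e x,e y)^{−1}e^{−(c∕2)d(Δ_x,Δ_y)}`.
[cite: Dimock2004QED3TorusII, §3.3 Thm 2 (194)–(195) p.30 L1–5, Lemma 3 (197)–(198) p.30 L14–22, proof (199)–(203) p.30 L24 – p.31 L6; §3.1 (124)–(126) p.20 L82 – p.21 L15] -/
theorem dimock_thm2_torus_lemma3 [CompleteSpace E] {c η t Gg aQ C₀ C₀' : ℝ} {G₂ : ℝ≥0} {Ns ℓb R r : ℕ} {τ : ℤ}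
    [NeZero Ns] [NeZero ℓb]
    (hmod : Nb = M₀ * Nc) (hmodS : Ns = ℓb * Nb) (hNc : 2 * |t| + 6 / 5 < (Nc : ℝ))
    (e : X → TPt 3 Ns) (he : Function.Injective e)
    (β : X → TPt 3 Nb) (hβ : ∀ x, β x = czmap ℓb Nb (e x)) (ctr : TPt 3 Nb → X) (hctr : ∀ b, β (ctr b) = b)
    (hblk : ∀ b, (univ.filter fun u => β u = b).card ≤ R ^ 3) (hR : 1 ≤ R) (hη : 0 < η) (hc : 0 < c)
    (hGg : ∀ z : Fin 3 → ℝ, ‖fderiv ℝ (g : (Fin 3 → ℝ) → ℝ) z‖ ≤ Gg)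
    (hG₂ : LipschitzWith G₂ (fderiv ℝ (g : (Fin 3 → ℝ) → ℝ)))
    {cz : TPt 3 Nc → TPt 3 Ns} (hcz : ∀ w, cz w = proj Ns fun i => ((ℓb * M₀ : ℕ) : ℤ) * natLift w i)
    (hτ0 : 0 ≤ τ) (hτℓ : τ < (ℓb * M₀ : ℕ)) (hτ : |((ℓb * M₀ : ℕ) : ℝ) * t - τ| ≤ 1 / 2)
    (hr : (3 / 5 : ℝ) * ((ℓb * M₀ : ℕ) : ℝ) + 1 / 2 ≤ r)
    (hwin : (((ℓb * M₀ : ℕ)) : ℝ) * (|t| + 3 / 5) + ℓb + 2 < (Ns : ℝ) / 2)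
    (H : TPt 3 Nc → Matrix X X E)
    (hH : ∀ w, H w = Matrix.diagonal fun x =>
      algebraMap ℝ E (g (fun i => (((ℓb * M₀ : ℕ) : ℝ))⁻¹ * (((e x - cz w) i).valMinAbs : ℝ) - t)))
    (nbp nbm : Fin 3 → X → X) (hnbp : ∀ μ x, e (nbp μ x) = e x + proj Ns (Pi.single μ 1))
    (hnbm : ∀ μ x, e (nbm μ x) = e x + proj Ns (-Pi.single μ 1))
    (A AD AQ : Matrix X X E) (hA : ∀ x u, x ≠ u → A x u = AD x u + AQ x u)
    (hAD : ∀ (S : X → E) (x : X), ∑ u, AD x u * S u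
      = (-(η⁻¹ ^ 2)) • ∑ μ, (S (nbp μ x) + S (nbm μ x) - (2 : ℝ) • S x))
    (hADr : ∀ x u, AD x u ≠ 0 → e u ∈ tball (e x) 1)
    (hAQ : ∀ x u, AQ x u ≠ 0 → β u = β x) (haQ : 0 ≤ aQ) (hAQn : ∀ x u, ‖AQ x u‖ ≤ aQ)
    (hRρ : 2 * (r / ℓb + 1) + 2 < 2 * M₀) (hRρ' : (r / ℓb + 1) + 2 < M₀)
    (G : TPt 3 Nc → Matrix X X E) (h136 : ∀ w, H w * A * G w = H w)
    (hC₀ : 0 ≤ C₀) (hC₀' : 0 ≤ C₀')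
    (h198a : ∀ w u v, ‖G w u v‖ ≤ C₀ * ((η ^ 3 * (η * dOne (vmaVec (e u - e v))) ^ (-(1 : ℝ)))
      * Real.exp (-(c * torusDist (β u) (β v)))))
    (h198b : ∀ w x μ v, ‖G w (nbp μ x) v - G w x v‖ ≤ C₀' * (η * ((η ^ 3 *
      ((η * dOne (vmaVec (e x - e v))) ^ (-(1 : ℝ)) + (η * dOne (vmaVec (e x - e v))) ^ (-(2 : ℝ))))
        * Real.exp (-(c * torusDist (β x) (β v))))))
    (hlarge : 2 * (((3 ^ 3 : ℕ) : ℝ) *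
        (((3 * Real.exp (c * 6) * (4 * G₂ * C₀ * ((η * ℓb) ^ 2)⁻¹ + 5 * Gg * C₀' * (η * ℓb)⁻¹)
            + Gg * aQ * C₀ * (2 * (η * R) ^ 3 + 2 * blockConst 1 * (η * R) ^ 2 * (η * ℓb)) / η ^ 3))
          * (2 ^ ((1 : ℝ) + 1) * blockConst 1 * (η * R) ^ ((3 : ℝ) - 1)
            + 2 * (Real.sqrt 8 * blockConst 2 * (η * R))
            + 2 ^ ((2 : ℝ) + 1) * blockConst 2 * (η * R) ^ ((3 : ℝ) - 2)) * K₁ 3 (c / 2))) ≤ (M₀ : ℝ)) :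
    (∀ x y, Summable fun n => (Gstar H G * Kop A H G ^ n) x y) ∧
    A * walkExpansion A H G = 1 ∧
    ∀ x y, ‖walkExpansion A H G x y‖
      ≤ 2 * ((3 ^ 3 : ℕ) : ℝ) * C₀ * ((η ^ 3 * (η * dOne (vmaVec (e x - e y))) ^ (-(1 : ℝ)))
          * Real.exp (-(c / 2) * torusDist (β x) (β y))) := by
  have hℓb : 0 < ℓb := Nat.pos_of_ne_zero (NeZero.ne ℓb)
  have hGg0 : 0 ≤ Gg := (norm_nonneg _).trans (hGg 0)
  have hC1 : 0 ≤ blockConst 1 := zero_le_one.trans (one_le_blockConst (α := 1) (by norm_num))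
  have hC₁ : 0 ≤ (3 * Real.exp (c * 6) * (4 * G₂ * C₀ * ((η * ℓb) ^ 2)⁻¹ + 5 * Gg * C₀' * (η * ℓb)⁻¹)
      + Gg * aQ * C₀ * (2 * (η * R) ^ 3 + 2 * blockConst 1 * (η * R) ^ 2 * (η * ℓb)) / η ^ 3) := by positivity
  -- the site range of `A`: one block
  have hArange : ∀ x y, A x y ≠ 0 → e y ∈ tball (e x) ℓb := by
    intro x y hxy
    by_cases hxy' : x = y
    · subst hxy'
      exact self_mem_tball _ _
    · rw [hA x y hxy'] at hxy
      by_cases hD : AD x y = 0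
      · rw [hD, zero_add] at hxy
        have h1 := mem_tball_of_czmap_eq (Ls := ℓb) (Nc := Nb) hmodS
          (show czmap ℓb Nb (e y) = czmap ℓb Nb (e x) by rw [← hβ, ← hβ]; exact hAQ x y hxy)
        exact tball_mono (Nat.sub_le ℓb 1) h1
      · exact tball_mono (by omega) (hADr x y hD)
  -- the first links against (198)
  have hf1 : ∀ (w : TPt 3 Nc) (x : X),
      |g (fun i => (((ℓb * M₀ : ℕ) : ℝ))⁻¹ * (((e x - cz w) i).valMinAbs : ℝ) - t)| ≤ 1 :=
    fun w x => abs_le.2 ⟨by linarith [g_nonneg (fun i => (((ℓb * M₀ : ℕ) : ℝ))⁻¹ *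
      (((e x - cz w) i).valMinAbs : ℝ) - t)], g_le_one _⟩
  have h0 : ∀ w u v, ‖link0 H G w u v‖ ≤ C₀ * ((η ^ 3 * (η * dOne (vmaVec (e u - e v))) ^ (-(1 : ℝ)))
      * Real.exp (-(c * torusDist (β u) (β v)))) := fun w u v =>
    (norm_link0_le (fun w x => g (fun i => (((ℓb * M₀ : ℕ) : ℝ))⁻¹ * (((e x - cz w) i).valMinAbs : ℝ) - t))
      hH hf1 G w u v).trans (h198a w u v)
  -- (201) on the torus
  have hR' := fun w u v => eq201_torus (M₀ := M₀) hmodS e he β hβ hη hc.le hR hblk hGg hG₂ hwin cz H hH nbp nbm hnbp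
    hnbm A AD AQ hA hAD hAQ haQ hAQn G hC₀ hC₀' h198a h198b w u v
  have hdiv : ℓb / ℓb + 1 = 2 := by rw [Nat.div_self hℓb]
  exact dimock_thm2_torus_printed hmod hmodS hNc e he β hβ ctr hctr hblk hR hη hc hcz hτ0 hτℓ hτ hr H hH A hArange
    (by rw [hdiv]; exact hRρ) (by rw [hdiv]; exact hRρ') G h136 hC₀ hC₁ h0 hR' hlarge

/-- **THEOREM 2 (195) with ONE `M₀` FOR ALL SCALES AND VOLUMES** (the boson twin of `dimock_thm1_torus_uniform`): in
`dimock_thm2_torus_lemma3` take UNIT blocks (`ηℓ_b = 1`, `R = ℓ_b`) and the printed size of the averaging kernel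
`a_Q = aη³` ((197): `QᵀaQ` on one scale against `Ση³`; the Laplacian carries its own `η^{−2}`).  Then
`C₁ = 3e^{6c}(4G₂C₀ + 5GC₀′) + GaC₀(2 + 2C(1))` and `θ′ = 4C(1) + 2√8C(2) + 8C(2)` — independent of `k` and of the
volume — and *"Let `M_0` be sufficiently large"* is the single condition `2·3³·C₁θ′K₁(3,c∕2) ≤ M₀`.
[cite: Dimock2004QED3TorusII, §3.3 Thm 2 (195) p.30 L1–5 («Let M_0 be sufficiently large»), proof (199)–(203) p.30 L24 – p.31 L6] -/
theorem dimock_thm2_torus_uniform [CompleteSpace E] {c η t Gg a C₀ C₀' : ℝ} {G₂ : ℝ≥0} {Ns ℓb r : ℕ} {τ : ℤ}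
    [NeZero Ns] [NeZero ℓb]
    (hmod : Nb = M₀ * Nc) (hmodS : Ns = ℓb * Nb) (hNc : 2 * |t| + 6 / 5 < (Nc : ℝ))
    (e : X → TPt 3 Ns) (he : Function.Injective e)
    (β : X → TPt 3 Nb) (hβ : ∀ x, β x = czmap ℓb Nb (e x)) (ctr : TPt 3 Nb → X) (hctr : ∀ b, β (ctr b) = b)
    (hblk : ∀ b, (univ.filter fun u => β u = b).card ≤ ℓb ^ 3) (hη : 0 < η) (hunit : η * ℓb = 1) (hc : 0 < c)
    (hGg : ∀ z : Fin 3 → ℝ, ‖fderiv ℝ (g : (Fin 3 → ℝ) → ℝ) z‖ ≤ Gg)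
    (hG₂ : LipschitzWith G₂ (fderiv ℝ (g : (Fin 3 → ℝ) → ℝ)))
    {cz : TPt 3 Nc → TPt 3 Ns} (hcz : ∀ w, cz w = proj Ns fun i => ((ℓb * M₀ : ℕ) : ℤ) * natLift w i)
    (hτ0 : 0 ≤ τ) (hτℓ : τ < (ℓb * M₀ : ℕ)) (hτ : |((ℓb * M₀ : ℕ) : ℝ) * t - τ| ≤ 1 / 2)
    (hr : (3 / 5 : ℝ) * ((ℓb * M₀ : ℕ) : ℝ) + 1 / 2 ≤ r)
    (hwin : (((ℓb * M₀ : ℕ)) : ℝ) * (|t| + 3 / 5) + ℓb + 2 < (Ns : ℝ) / 2)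
    (H : TPt 3 Nc → Matrix X X E)
    (hH : ∀ w, H w = Matrix.diagonal fun x =>
      algebraMap ℝ E (g (fun i => (((ℓb * M₀ : ℕ) : ℝ))⁻¹ * (((e x - cz w) i).valMinAbs : ℝ) - t)))
    (nbp nbm : Fin 3 → X → X) (hnbp : ∀ μ x, e (nbp μ x) = e x + proj Ns (Pi.single μ 1))
    (hnbm : ∀ μ x, e (nbm μ x) = e x + proj Ns (-Pi.single μ 1))
    (A AD AQ : Matrix X X E) (hA : ∀ x u, x ≠ u → A x u = AD x u + AQ x u)
    (hAD : ∀ (S : X → E) (x : X), ∑ u, AD x u * S u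
      = (-(η⁻¹ ^ 2)) • ∑ μ, (S (nbp μ x) + S (nbm μ x) - (2 : ℝ) • S x))
    (hADr : ∀ x u, AD x u ≠ 0 → e u ∈ tball (e x) 1)
    (hAQ : ∀ x u, AQ x u ≠ 0 → β u = β x) (ha : 0 ≤ a) (hAQn : ∀ x u, ‖AQ x u‖ ≤ a * η ^ 3)
    (hRρ : 2 * (r / ℓb + 1) + 2 < 2 * M₀) (hRρ' : (r / ℓb + 1) + 2 < M₀)
    (G : TPt 3 Nc → Matrix X X E) (h136 : ∀ w, H w * A * G w = H w)
    (hC₀ : 0 ≤ C₀) (hC₀' : 0 ≤ C₀')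
    (h198a : ∀ w u v, ‖G w u v‖ ≤ C₀ * ((η ^ 3 * (η * dOne (vmaVec (e u - e v))) ^ (-(1 : ℝ)))
      * Real.exp (-(c * torusDist (β u) (β v)))))
    (h198b : ∀ w x μ v, ‖G w (nbp μ x) v - G w x v‖ ≤ C₀' * (η * ((η ^ 3 *
      ((η * dOne (vmaVec (e x - e v))) ^ (-(1 : ℝ)) + (η * dOne (vmaVec (e x - e v))) ^ (-(2 : ℝ))))
        * Real.exp (-(c * torusDist (β x) (β v))))))
    (hlarge : 2 * (27 * (((3 * Real.exp (c * 6) * (4 * G₂ * C₀ + 5 * Gg * C₀') + Gg * a * C₀ * (2 + 2 * blockConst 1))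
        * (4 * blockConst 1 + 2 * (Real.sqrt 8 * blockConst 2) + 8 * blockConst 2)) * K₁ 3 (c / 2))) ≤ (M₀ : ℝ)) :
    (∀ x y, Summable fun n => (Gstar H G * Kop A H G ^ n) x y) ∧
    A * walkExpansion A H G = 1 ∧
    ∀ x y, ‖walkExpansion A H G x y‖
      ≤ 2 * ((3 ^ 3 : ℕ) : ℝ) * C₀ * ((η ^ 3 * (η * dOne (vmaVec (e x - e y))) ^ (-(1 : ℝ)))
          * Real.exp (-(c / 2) * torusDist (β x) (β y))) := by
  have hℓb : 0 < ℓb := Nat.pos_of_ne_zero (NeZero.ne ℓb)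
  have hR : 1 ≤ ℓb := hℓb
  have hη0 : η ≠ 0 := hη.ne'
  have h4 : (2 : ℝ) ^ ((1 : ℝ) + 1) = 4 := by
    rw [show (1 : ℝ) + 1 = ((2 : ℕ) : ℝ) by norm_num, Real.rpow_natCast]
    norm_num
  have h8 : (2 : ℝ) ^ ((2 : ℝ) + 1) = 8 := by
    rw [show (2 : ℝ) + 1 = ((3 : ℕ) : ℝ) by norm_num, Real.rpow_natCast]
    norm_num
  have h1a : (η * (ℓb : ℝ)) ^ ((3 : ℝ) - 1) = 1 := by rw [hunit, Real.one_rpow]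
  have h1b : (η * (ℓb : ℝ)) ^ ((3 : ℝ) - 2) = 1 := by rw [hunit, Real.one_rpow]
  have key : ((3 * Real.exp (c * 6) * (4 * G₂ * C₀ * ((η * ℓb) ^ 2)⁻¹ + 5 * Gg * C₀' * (η * ℓb)⁻¹)
        + Gg * (a * η ^ 3) * C₀ * (2 * (η * ℓb) ^ 3 + 2 * blockConst 1 * (η * ℓb) ^ 2 * (η * ℓb)) / η ^ 3))
      * (2 ^ ((1 : ℝ) + 1) * blockConst 1 * (η * ℓb) ^ ((3 : ℝ) - 1)
        + 2 * (Real.sqrt 8 * blockConst 2 * (η * ℓb)) + 2 ^ ((2 : ℝ) + 1) * blockConst 2 * (η * ℓb) ^ ((3 : ℝ) - 2))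
      = (3 * Real.exp (c * 6) * (4 * G₂ * C₀ + 5 * Gg * C₀') + Gg * a * C₀ * (2 + 2 * blockConst 1))
        * (4 * blockConst 1 + 2 * (Real.sqrt 8 * blockConst 2) + 8 * blockConst 2) := by
    rw [h1a, h1b, hunit, h4, h8]
    field_simp
  have h27 : ((3 ^ 3 : ℕ) : ℝ) = 27 := by norm_num
  have hlarge' : 2 * (((3 ^ 3 : ℕ) : ℝ) *
      (((3 * Real.exp (c * 6) * (4 * G₂ * C₀ * ((η * ℓb) ^ 2)⁻¹ + 5 * Gg * C₀' * (η * ℓb)⁻¹)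
          + Gg * (a * η ^ 3) * C₀ * (2 * (η * ℓb) ^ 3 + 2 * blockConst 1 * (η * ℓb) ^ 2 * (η * ℓb)) / η ^ 3))
        * (2 ^ ((1 : ℝ) + 1) * blockConst 1 * (η * ℓb) ^ ((3 : ℝ) - 1)
          + 2 * (Real.sqrt 8 * blockConst 2 * (η * ℓb))
          + 2 ^ ((2 : ℝ) + 1) * blockConst 2 * (η * ℓb) ^ ((3 : ℝ) - 2)) * K₁ 3 (c / 2))) ≤ (M₀ : ℝ) := by
    rw [key, h27]
    exact hlarge
  exact dimock_thm2_torus_lemma3 hmod hmodS hNc e he β hβ ctr hctr hblk hR hη hc hGg hG₂ hcz hτ0 hτℓ hτ hr hwin H hH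
    nbp nbm hnbp hnbm A AD AQ hA hAD hADr hAQ (by positivity) hAQn hRρ hRρ' G h136 hC₀ hC₀' h198a h198b hlarge'

/-- **THEOREM 2 (195) on the 3-torus, EVERY SCALE AND VOLUME, with the bookkeeping discharged** (boson twin of
`dimock_thm1_torus_uniform'`): bump centred at the cube corners (`t = τ = 0`), support radius `r = ℓ_b(M₀ − 4)`, at
least two cubes per direction; the size conditions follow from `M₀ ≥ 12`, leaving `M₀ ≥ 12`, the explicit largeness
`2·3³·C₁θ′K₁(3,c∕2) ≤ M₀`, LEMMA 3 and the kernel shapes as the ONLY hypotheses.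
[cite: Dimock2004QED3TorusII, §3.3 Thm 2 (195) p.30 L1–5, Lemma 3 (197)–(198) p.30 L14–22, proof (199)–(203) p.30 L24 – p.31 L6] -/
theorem dimock_thm2_torus_uniform' [CompleteSpace E] {c η Gg a C₀ C₀' : ℝ} {G₂ : ℝ≥0} {Ns ℓb : ℕ}
    [NeZero Ns] [NeZero ℓb]
    (hmod : Nb = M₀ * Nc) (hmodS : Ns = ℓb * Nb) (hNc : 2 ≤ Nc) (hM₀ : 12 ≤ M₀)
    (e : X → TPt 3 Ns) (he : Function.Injective e)
    (β : X → TPt 3 Nb) (hβ : ∀ x, β x = czmap ℓb Nb (e x)) (ctr : TPt 3 Nb → X) (hctr : ∀ b, β (ctr b) = b)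
    (hblk : ∀ b, (univ.filter fun u => β u = b).card ≤ ℓb ^ 3) (hη : 0 < η) (hunit : η * ℓb = 1) (hc : 0 < c)
    (hGg : ∀ z : Fin 3 → ℝ, ‖fderiv ℝ (g : (Fin 3 → ℝ) → ℝ) z‖ ≤ Gg)
    (hG₂ : LipschitzWith G₂ (fderiv ℝ (g : (Fin 3 → ℝ) → ℝ)))
    {cz : TPt 3 Nc → TPt 3 Ns} (hcz : ∀ w, cz w = proj Ns fun i => ((ℓb * M₀ : ℕ) : ℤ) * natLift w i)
    (H : TPt 3 Nc → Matrix X X E)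
    (hH : ∀ w, H w = Matrix.diagonal fun x =>
      algebraMap ℝ E (g (fun i => (((ℓb * M₀ : ℕ) : ℝ))⁻¹ * (((e x - cz w) i).valMinAbs : ℝ))))
    (nbp nbm : Fin 3 → X → X) (hnbp : ∀ μ x, e (nbp μ x) = e x + proj Ns (Pi.single μ 1))
    (hnbm : ∀ μ x, e (nbm μ x) = e x + proj Ns (-Pi.single μ 1))
    (A AD AQ : Matrix X X E) (hA : ∀ x u, x ≠ u → A x u = AD x u + AQ x u)
    (hAD : ∀ (S : X → E) (x : X), ∑ u, AD x u * S u
      = (-(η⁻¹ ^ 2)) • ∑ μ, (S (nbp μ x) + S (nbm μ x) - (2 : ℝ) • S x))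
    (hADr : ∀ x u, AD x u ≠ 0 → e u ∈ tball (e x) 1)
    (hAQ : ∀ x u, AQ x u ≠ 0 → β u = β x) (ha : 0 ≤ a) (hAQn : ∀ x u, ‖AQ x u‖ ≤ a * η ^ 3)
    (G : TPt 3 Nc → Matrix X X E) (h136 : ∀ w, H w * A * G w = H w)
    (hC₀ : 0 ≤ C₀) (hC₀' : 0 ≤ C₀')
    (h198a : ∀ w u v, ‖G w u v‖ ≤ C₀ * ((η ^ 3 * (η * dOne (vmaVec (e u - e v))) ^ (-(1 : ℝ)))
      * Real.exp (-(c * torusDist (β u) (β v)))))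
    (h198b : ∀ w x μ v, ‖G w (nbp μ x) v - G w x v‖ ≤ C₀' * (η * ((η ^ 3 *
      ((η * dOne (vmaVec (e x - e v))) ^ (-(1 : ℝ)) + (η * dOne (vmaVec (e x - e v))) ^ (-(2 : ℝ))))
        * Real.exp (-(c * torusDist (β x) (β v))))))
    (hlarge : 2 * (27 * (((3 * Real.exp (c * 6) * (4 * G₂ * C₀ + 5 * Gg * C₀') + Gg * a * C₀ * (2 + 2 * blockConst 1))
        * (4 * blockConst 1 + 2 * (Real.sqrt 8 * blockConst 2) + 8 * blockConst 2)) * K₁ 3 (c / 2))) ≤ (M₀ : ℝ)) :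
    (∀ x y, Summable fun n => (Gstar H G * Kop A H G ^ n) x y) ∧
    A * walkExpansion A H G = 1 ∧
    ∀ x y, ‖walkExpansion A H G x y‖
      ≤ 2 * ((3 ^ 3 : ℕ) : ℝ) * C₀ * ((η ^ 3 * (η * dOne (vmaVec (e x - e y))) ^ (-(1 : ℝ)))
          * Real.exp (-(c / 2) * torusDist (β x) (β y))) := by
  have hℓb : 0 < ℓb := Nat.pos_of_ne_zero (NeZero.ne ℓb)
  have hℓbr : (1 : ℝ) ≤ ℓb := by exact_mod_cast hℓb
  have hM₀r : (12 : ℝ) ≤ M₀ := by exact_mod_cast hM₀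
  have hNcr : (2 : ℝ) ≤ Nc := by exact_mod_cast hNc
  have hM₀4 : 4 ≤ M₀ := le_trans (by norm_num) hM₀
  have hprod : 12 * (ℓb : ℝ) ≤ (ℓb : ℝ) * M₀ := by nlinarith
  have hprod2 : 2 * ((ℓb : ℝ) * M₀) ≤ (ℓb : ℝ) * M₀ * Nc := by nlinarith
  have hℓ : (((ℓb * M₀ : ℕ)) : ℝ) = (ℓb : ℝ) * M₀ := by push_cast; ring
  have hH' : ∀ w, H w = Matrix.diagonal fun x =>
      algebraMap ℝ E (g (fun i => (((ℓb * M₀ : ℕ) : ℝ))⁻¹ * (((e x - cz w) i).valMinAbs : ℝ) - 0)) := by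
    simp_rw [sub_zero]
    exact hH
  have hdiv : ℓb * (M₀ - 4) / ℓb = M₀ - 4 := Nat.mul_div_cancel_left (M₀ - 4) hℓb
  refine dimock_thm2_torus_uniform (t := 0) (τ := 0) (r := ℓb * (M₀ - 4)) hmod hmodS ?_ e he β hβ ctr hctr hblk hη
    hunit hc hGg hG₂ hcz le_rfl ?_ ?_ ?_ ?_ H hH' nbp nbm hnbp hnbm A AD AQ hA hAD hADr hAQ ha hAQn ?_ ?_ G h136 hC₀
    hC₀' h198a h198b hlarge
  · rw [abs_zero, mul_zero, zero_add]
    linarith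
  · exact_mod_cast Nat.mul_pos hℓb (by omega : 0 < M₀)
  · rw [mul_zero, Int.cast_zero, sub_zero, abs_zero]
    norm_num
  · rw [hℓ]
    push_cast [Nat.cast_sub hM₀4]
    nlinarith
  · rw [hℓ, abs_zero, zero_add]
    have hNs : (Ns : ℝ) = (ℓb : ℝ) * M₀ * Nc := by rw [hmodS, hmod]; push_cast; ring
    rw [hNs]
    nlinarith
  · rw [hdiv]
    omega
  · rw [hdiv]
    omega

end Theorem2

end QED3TorusII

end Literature.MathematicalPhysics.QuantumFieldTheory.Dimock2011to13
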